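import Summits.PneNP.PneNP.Theses.RamseyUncertifiable
import Literature.Computability.MetaComplexity.ResolutionStepLists
import Literature.Combinatorics.SimpleGraph.RamseyNumbers

/-!
# Disproof of `ResolutionUncertainty` — findings

Work file of the standing crux disprover (`cdisprove-stmt-PneNP-9816`, route
`RamseyUncertifiable`, crux `Summit.PneNP.PneNP.Theses.RamseyUncertifiable.ResolutionUncertainty`).
Everything below is sorry-free (axioms `propext`, `Classical.choice`, `Quot.sound`).

**The crux.** `∃ ε > 0, ∃ n₀, ∀ n ≥ n₀, ∀ G : SimpleGraph (Fin n)`, every pair of resolution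
refutations `π₁` of `Clique(G, k(n))` and `π₂` of `Clique(Ḡ, k(n))`, `k(n) = ⌈log₂ n²⌉`, has
`max |π₁| |π₂| ≥ n^{ε log₂ n}` (unary block encoding, `IsResRefutation` of the tree).

**Verdict so far: NOT refuted; resists.** It is the open problem of LPRT (arXiv:1303.3166 §1.1) /
ABdRLNR (arXiv:2012.09476 §9) for general dag-like resolution. A disproof needs an infinite family
of graphs that are PROVABLY Ramsey at the Erdős threshold `2 log₂ n` (no explicit such family is
known — explicit constructions reach only `2^{(log log n)^C}`; Paley graphs have `ω ≤ √p` proved)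
TOGETHER WITH `n^{o(log n)}` dag-like refutations of their clique formulas (nothing below the
brute-force `n^{O(log n)}` is known for any Ramsey graph; regular resolution is `n^{Ω(log n)}`
a.a.s. on `G(n,1/2)`, ABdRLNR Thm 5.1). Small/finite models cannot bite (`∃ ε`, `∃ n₀`).

## Literature status (re-checked 2026-08-16; searchd local FTS + OpenAlex/S2 degraded, arXiv live)

* NEW since the item was filed: A. Atserias, *Hard Clique Formulas for Resolution*, arXiv:2601.12503
  (Jan 2026), Thm 1: worst-case `n^{Ω(k)}` length lower bounds for GENERAL (dag-like) Resolution
  refutations of the map-encoding `clique(G,k)` (= this crux's CNF: `kn` variables, clique /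
  functionality / non-edge clauses) and of the block encoding, for all `k₀ ≤ k(n) ≤ n^{1/c₀}`, via a
  reduction from exponentially hard sparse 3-CNFs into `k`-partite graphs `G` (`n = k·2^{3rN/k}`).
  This SOLVES the worst-case question quoted as open in the item's `why_might_fail` (BGLR12,
  ABdRLNR21 [Open Problem 7.4 of the proof-complexity survey], OWR 15/2024) — but it does NOT touch
  the crux: the hard graphs are `k`-partite, so `α(G) ≥ n/k ≫ 2 log₂ n`, `Clique(Ḡ, k)` is
  satisfiable and the crux is vacuous at them. Hardness for EVERY Ramsey graph (instance
  independence, LPRT arXiv:1303.3166 §1.1) and even for `G(n,1/2)` a.a.s. in general Resolution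
  (ABdRLNR arXiv:2012.09476 §9, regular case Thm 5.1) remain open; no upper bound below brute force
  is known for any Ramsey graph. Nothing found contradicting or proving the crux.

## Findings (all `theorem`s below)

* READ-BACK. `resolutionUncertainty_iff : ResolutionUncertainty ↔ …` restates the crux through the
  named CNF `cliqueCNF` (`Iff.rfl`). Harmless elaboration quirk: in the clique-member and
  functionality blocks the vertex binders live in `ℕ` and `List.finRange n` enters through the
  monadic coercion `↑(List.finRange n) : List ℕ` (`mem_coe_finRange_iff`); same clauses. The edge
  block includes `u = v` (looplessness), so satisfying assignments are exactly the CONSISTENT block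
  assignments = ordered `k`-cliques (`cliqueFree_iff_forall_not_consistent`); soundness of
  `IsResRefutation` (tree) makes non-Ramsey `G` vacuous, as the docstring says.
* (a) LOAD-BEARING: both refutation hypotheses are needed —
  `resolutionUncertainty_false_without_complement : ¬ WithoutComplement` (drop `π₂`: the empty graph
  `⊥` has a `4(n+1)²`-line refutation of `Clique(⊥, k)`, `exists_refutation_of_noEdges`) and
  `resolutionUncertainty_false_without_graph : ¬ WithoutGraph` (drop `π₁`: `G = ⊤`). Any proof must
  use that BOTH `G` and `Ḡ` are `K_{k(n)}`-free, i.e. genuinely Ramsey structure. `n₀` is not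
  load-bearing (absorbed by shrinking `ε`; not formalised).
* (b) TIGHTNESS (brute force = the decision tree over block assignments, realised through the tree's
  `StepList.exists_isResDerivation`): for EVERY `adj` without a consistent `k`-assignment,
  `Clique(adj,k)` has a refutation with `≤ 4(n+1) Σ_{t≤k} C_t` lines (`exists_refutation_le_count`,
  `C_t` = number of consistent `Fin t → Fin n` = `t! · #t-cliques`), hence `≤ 4(k+1)(n+1)^{k+1}`
  (`exists_refutation_le_pow`) and `≤ 4(w+1)(n+1)^{w+1}` whenever `ω ≤ w`, INDEPENDENTLY of `k`
  (`exists_refutation_le_pow_cliqueNum`; at the threshold `exists_refutation_at_threshold[_cliqueNum]`):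
  the crux's `max` is at most `n^{min(ω(G),α(G)) + O(1)}`, so hardness `n^{ε log₂ n}` needs BOTH
  `ω(G), α(G) ≥ (ε − o(1)) log₂ n`.
* (b') BOUNDARY `ε ≤ 1/2`: `exists_ramsey_few_cliques` (Erdős's count plus a first-moment bound,
  over all edge sets `E ⊆ Sym2 (Fin n)`: some graph is Ramsey at `k` AND has
  `2^{C(t,2)} C_t ≤ 8(k+1) n^t` on both sides for all `t ≤ k`, whenever `4C(n,k) < 2^{C(k,2)}`),
  `exists_ramsey_cheap` (at `n = 2^m`, `m ≥ 2`: a Ramsey graph with BOTH clique formulas refuted in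
  `budget m ≤ 2^{(m²+m)/2 + 3m + 8} = n^{(1/2+o(1)) log₂ n}` lines), whence
  `eps_le_half_of_with : ResolutionUncertaintyWith ε → ε ≤ 1/2` and
  `not_resolutionUncertaintyWith_of_half_lt` (also the weaker `eps_le_two_of_with`). So the crux is
  exactly the assertion that dag-like resolution cannot beat brute force by more than the exponent's
  constant on random-like Ramsey graphs: TRUE ⇒ `0 < ε ≤ 1/2`.
* (c) STRENGTHENINGS REFUTED: `not_allExponents' : ¬ AllExponents` (the `∀ ε` / `n^{ω(log n)}`
  version), `not_resolutionUncertaintyWith_of_half_lt` (any fixed `ε > 1/2`), the one-sided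
  versions (a).
* SUPPORT ITEM PROVED on the way: `ramseyAbundant_holds : RamseyAbundant` (stmt-PneNP-9821, Erdős
  1947 at the exact threshold, from `Literature…erdos1947_ramsey_lower_holds` + `(k!)² > 2^{k+2}`,
  `n² ≤ 2^{k(n)}`); hence the crux's hypotheses are satisfiable at every `n ≥ 3`
  (`hypotheses_satisfiable`), i.e. the `∀ π₁ π₂` is never vacuous from `n = 3` on.
* (d) Targets: none (payload `stuck_stubs = []`).
* (e) Not attempted in Lean: Paley family (Ramsey-ness unprovable today: `ω(P_p) ≤ √p` only);
  `n₀`-removal; anything below `ε = 1/2` (would need a dag-like refutation beating brute force on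
  random graphs — itself an open problem, the regular-resolution LOWER bound of ABdRLNR Thm 5.1 says
  `n^{Ω(log n)}` there).
-/

set_option linter.dupNamespace false

namespace Summit.PneNP.PneNP.Cruxes.ResolutionUncertainty.Disproof

open Literature.Computability.Complexity Literature.Computability.MetaComplexity
open Summit.PneNP.PneNP.Theses.RamseyUncertifiable

/-! ## The crux's inline objects, named -/

/-- The unary clique CNF `Clique(adj, k)` on vertex set `Fin n`, VERBATIM the `cnf` let-bound in
the crux (`ResolutionUncertainty`): block variables `x_{i,v} ↦ i * n + v`; clique-member clauses
`⋁_v x_{i,v}` (`i < k`), functionality clauses `¬x_{i,u} ∨ ¬x_{i,v}` (`u < v`), edge clauses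
`¬x_{i,u} ∨ ¬x_{j,v}` (`i ≠ j`, `adj u v = false`, in particular `u = v` for loopless `adj`). -/
def cliqueCNF (n k : ℕ) (adj : Fin n → Fin n → Bool) : CNF ℕ :=
  ((List.range k).map fun i => (List.finRange n).map fun v => (i * n + (v : ℕ), true)) ++
  ((List.range k).flatMap fun i => (List.finRange n).flatMap fun u =>
      (List.finRange n).flatMap fun v =>
        if u < v then [[(i * n + (u : ℕ), false), (i * n + (v : ℕ), false)]] else []) ++
  ((List.range k).flatMap fun i => (List.range k).flatMap fun j =>
      (List.finRange n).flatMap fun u => (List.finRange n).flatMap fun v =>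
        if i ≠ j ∧ adj u v = false then [[(i * n + (u : ℕ), false), (j * n + (v : ℕ), false)]]
        else [])

/-- The Erdős threshold `k(n) = ⌈log₂ (n²)⌉ = ⌈2 log₂ n⌉` of the crux. -/
abbrev kR (n : ℕ) : ℕ := Nat.clog 2 (n ^ 2)

/-- The crux, restated through `cliqueCNF` / `kR` (definitional unfolding, `Iff.rfl`). -/
theorem resolutionUncertainty_iff :
    ResolutionUncertainty ↔
      ∃ ε : ℝ, 0 < ε ∧ ∃ n₀ : ℕ, ∀ n ≥ n₀, ∀ (G : SimpleGraph (Fin n)) [DecidableRel G.Adj],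
        ∀ π₁ π₂ : List (ResLine ℕ),
          IsResRefutation (cliqueCNF n (kR n) fun u v => decide (G.Adj u v)) π₁ →
          IsResRefutation (cliqueCNF n (kR n) fun u v => decide (Gᶜ.Adj u v)) π₂ →
          (n : ℝ) ^ (ε * Real.logb 2 n) ≤ max (π₁.length : ℝ) (π₂.length : ℝ) :=
  Iff.rfl

/-! ## Axiom bookkeeping -/

theorem clique_mem_cliqueCNF {n k : ℕ} (adj : Fin n → Fin n → Bool) {i : ℕ} (hi : i < k) :
    ((List.finRange n).map fun v => (i * n + (v : ℕ), true)) ∈ cliqueCNF n k adj := by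
  unfold cliqueCNF
  refine List.mem_append_left _ (List.mem_append_left _ ?_)
  exact List.mem_map.2 ⟨i, List.mem_range.2 hi, rfl⟩

/-- READ-BACK FINDING (harmless): in the clique-member and functionality blocks the binders
`u v` elaborate at type `ℕ` (the ascription `(u : ℕ)` fixes the binder type before
`List.finRange n` does), so `List.finRange n` enters through the monadic coercion
`(↑(List.finRange n) : List ℕ) = do let a ← List.finRange n; pure ↑a` — the same clauses. Only the
edge block (where `adj u v` forces `u v : Fin n`) binds vertices of type `Fin n`. -/
theorem mem_coe_finRange_iff {n u : ℕ} : u ∈ (↑(List.finRange n) : List ℕ) ↔ u < n := by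
  constructor
  · intro h
    simp at h
    obtain ⟨a, rfl⟩ := h
    exact a.isLt
  · intro h
    simp
    exact ⟨⟨u, h⟩, rfl⟩

theorem func_mem_cliqueCNF {n k : ℕ} (adj : Fin n → Fin n → Bool) {i : ℕ} (hi : i < k)
    {u v : ℕ} (hu : u < n) (hv : v < n) (huv : u < v) :
    [(i * n + u, false), (i * n + v, false)] ∈ cliqueCNF n k adj := by
  unfold cliqueCNF
  refine List.mem_append_left _ (List.mem_append_right _ ?_)
  refine List.mem_flatMap.2 ⟨i, List.mem_range.2 hi, List.mem_flatMap.2 ⟨u, mem_coe_finRange_iff.2 hu,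
    List.mem_flatMap.2 ⟨v, mem_coe_finRange_iff.2 hv, ?_⟩⟩⟩
  simp [huv]

theorem edge_mem_cliqueCNF {n k : ℕ} {adj : Fin n → Fin n → Bool} {i j : ℕ} (hi : i < k)
    (hj : j < k) (hij : i ≠ j) {u v : Fin n} (huv : adj u v = false) :
    [(i * n + (u : ℕ), false), (j * n + (v : ℕ), false)] ∈ cliqueCNF n k adj := by
  unfold cliqueCNF
  refine List.mem_append_right _ ?_
  refine List.mem_flatMap.2 ⟨i, List.mem_range.2 hi, List.mem_flatMap.2 ⟨j, List.mem_range.2 hj,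
    List.mem_flatMap.2 ⟨u, List.mem_finRange u, List.mem_flatMap.2 ⟨v, List.mem_finRange v, ?_⟩⟩⟩⟩
  simp [hij, huv]

theorem mem_clauseSet_of_mem {φ : CNF ℕ} {c : Clause ℕ} (hc : c ∈ φ) :
    c.toFinset ∈ clauseSet φ :=
  mem_clauseSet_iff.2 ⟨c, hc, rfl⟩

/-! ## Load-bearing analysis, part 1: BOTH refutation hypotheses are needed

Dropping the hypothesis on `π₂` (resp. `π₁`) leaves "every refutation of `Clique(G, k(n))` is
long for EVERY graph `G`" — false at the empty (resp. complete) graph, whose clique formula has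
a refutation with `O(n²)` lines. -/

section EmptyGraph

variable (n : ℕ)

/-- `D_{u,j} = {¬x_{0,u}} ∪ {x_{1,w} : j ≤ w < n}`. -/
def dCl (u j : ℕ) : Finset (Literal ℕ) :=
  insert (0 * n + u, false) ((Finset.Ico j n).image fun w => (1 * n + w, true))

/-- `F_j = {x_{0,w} : j ≤ w < n}`. -/
def fCl (j : ℕ) : Finset (Literal ℕ) :=
  (Finset.Ico j n).image fun w => (0 * n + w, true)

/-- The clause list of the short refutation of `Clique(empty graph, k)`, `k ≥ 2`. -/
def emptyGraphSteps : List (Finset (Literal ℕ)) :=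
  ((List.range n).flatMap fun u => (List.range (n + 1)).map (dCl n u)) ++
    (List.range (n + 1)).map (fCl n)

theorem length_emptyGraphSteps : (emptyGraphSteps n).length = (n + 1) ^ 2 := by
  simp [emptyGraphSteps, List.length_flatMap, List.sum_replicate]
  ring

theorem empty_mem_emptyGraphSteps : (∅ : Finset (Literal ℕ)) ∈ emptyGraphSteps n := by
  refine List.mem_append_right _ (List.mem_map.2 ⟨n, List.mem_range.2 (Nat.lt_succ_self n), ?_⟩)
  simp [fCl]

variable {n}

theorem stepList_emptyGraphSteps {k : ℕ} (hk : 2 ≤ k) {adj : Fin n → Fin n → Bool}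
    (hadj : ∀ u v, adj u v = false) :
    StepList (clauseSet (cliqueCNF n k adj)) (emptyGraphSteps n) := by
  have h0 : (0 : ℕ) < k := by omega
  have h1 : (1 : ℕ) < k := by omega
  refine StepList.append ?_ ?_
  · refine stepList_flatMap_range fun u hu => stepList_map_range fun j hj => ?_
    rcases j with _ | j
    · -- `D_{u,0}` is a weakening of the clique clause of block 1
      refine DerivStep.of_mem (Or.inl (Or.inl (mem_clauseSet_of_mem
        (clique_mem_cliqueCNF adj h1)))) ?_
      intro l hl
      obtain ⟨v, hv, rfl⟩ := List.mem_map.1 (List.mem_toFinset.1 hl)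
      simp only [dCl, Finset.mem_insert, Finset.mem_image, Finset.mem_Ico]
      exact Or.inr ⟨v, ⟨Nat.zero_le _, mem_coe_finRange_iff.1 hv⟩, rfl⟩
    · -- `D_{u,j+1}` is the resolvent of `D_{u,j}` and the edge axiom `¬x_{0,u} ∨ ¬x_{1,j}`
      have hjn : j < n := by omega
      refine DerivStep.of_res (D := dCl n u j)
        (E := ([(0 * n + ((⟨u, hu⟩ : Fin n) : ℕ), false),
                (1 * n + ((⟨j, hjn⟩ : Fin n) : ℕ), false)] : Clause ℕ).toFinset)
        (v := 1 * n + j) (Or.inr ⟨j, Nat.lt_succ_self j, rfl⟩)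
        (Or.inl (Or.inl (mem_clauseSet_of_mem
          (edge_mem_cliqueCNF h0 h1 (by decide) (hadj _ _))))) ?_ ?_ ?_ ?_
      · simp only [dCl, Finset.mem_insert, Finset.mem_image, Finset.mem_Ico]
        exact Or.inr ⟨j, ⟨le_rfl, hjn⟩, rfl⟩
      · simp
      · intro l hl
        simp only [dCl, Finset.mem_erase, Finset.mem_insert, Finset.mem_image,
          Finset.mem_Ico] at hl ⊢
        obtain ⟨hne, rfl | ⟨w, ⟨hjw, hwn⟩, rfl⟩⟩ := hl
        · exact Or.inl rfl
        · refine Or.inr ⟨w, ⟨?_, hwn⟩, rfl⟩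
          rcases Nat.eq_or_lt_of_le hjw with rfl | h
          · exact absurd rfl hne
          · exact h
      · intro l hl
        simp only [Finset.mem_erase, List.toFinset_cons, List.toFinset_nil,
          Finset.mem_insert, Finset.insert_empty, Finset.mem_singleton] at hl
        obtain ⟨hne, rfl | rfl⟩ := hl
        · simp [dCl]
        · exact absurd rfl hne
  · refine stepList_map_range fun j hj => ?_
    rcases j with _ | j
    · -- `F_0` is the clique clause of block 0
      refine DerivStep.of_mem (Or.inl (Or.inl (mem_clauseSet_of_mem
        (clique_mem_cliqueCNF adj h0)))) ?_
      intro l hl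
      obtain ⟨v, hv, rfl⟩ := List.mem_map.1 (List.mem_toFinset.1 hl)
      simp only [fCl, Finset.mem_image, Finset.mem_Ico]
      exact ⟨v, ⟨Nat.zero_le _, mem_coe_finRange_iff.1 hv⟩, rfl⟩
    · -- `F_{j+1}` is the resolvent of `F_j` and the unit clause `D_{j,n} = {¬x_{0,j}}`
      have hjn : j < n := by omega
      refine DerivStep.of_res (D := fCl n j) (E := dCl n j n) (v := 0 * n + j)
        (Or.inr ⟨j, Nat.lt_succ_self j, rfl⟩)
        (Or.inl (Or.inr ?_)) ?_ ?_ ?_ ?_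
      · simp only [Set.mem_setOf_eq, List.mem_flatMap, List.mem_range, List.mem_map]
        exact ⟨j, hjn, n, Nat.lt_succ_self n, rfl⟩
      · simp only [fCl, Finset.mem_image, Finset.mem_Ico]
        exact ⟨j, ⟨le_rfl, hjn⟩, rfl⟩
      · simp [dCl]
      · intro l hl
        simp only [fCl, Finset.mem_erase, Finset.mem_image, Finset.mem_Ico] at hl ⊢
        obtain ⟨hne, w, ⟨hjw, hwn⟩, rfl⟩ := hl
        refine ⟨w, ⟨?_, hwn⟩, rfl⟩
        rcases Nat.eq_or_lt_of_le hjw with rfl | h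
        · exact absurd rfl hne
        · exact h
      · intro l hl
        simp [dCl] at hl

/-- **Tightness at the empty graph.** For `k ≥ 2` and an edgeless `adj`, `Clique(adj, k)` has a
resolution refutation with at most `4 (n+1)²` lines. -/
theorem exists_refutation_of_noEdges {k : ℕ} (hk : 2 ≤ k) (adj : Fin n → Fin n → Bool)
    (hadj : ∀ u v, adj u v = false) :
    ∃ π : List (ResLine ℕ), IsResRefutation (cliqueCNF n k adj) π ∧
      π.length ≤ 4 * (n + 1) ^ 2 := by
  obtain ⟨π, hπ, hlen, hall⟩ := (stepList_emptyGraphSteps hk hadj).exists_isResDerivation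
  obtain ⟨l, hl, hl0⟩ := hall ∅ (empty_mem_emptyGraphSteps n)
  exact ⟨π, ⟨hπ, l, hl, hl0⟩, by simpa [length_emptyGraphSteps] using hlen⟩

end EmptyGraph


/-! ### Numerics at `n = 2^m` -/

/-- At `n = 2^m` the crux's bound `n^{c log₂ n}` is `2^{c m²}`. -/
theorem rpow_logb_two_pow (m : ℕ) (c : ℝ) :
    ((2 ^ m : ℕ) : ℝ) ^ (c * Real.logb 2 ((2 ^ m : ℕ) : ℝ)) = (2 : ℝ) ^ (c * m * m) := by
  have h2 : ((2 ^ m : ℕ) : ℝ) = (2 : ℝ) ^ (m : ℝ) := by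
    rw [Nat.cast_pow, Nat.cast_ofNat, Real.rpow_natCast]
  rw [h2, Real.logb_rpow (by norm_num) (by norm_num), ← Real.rpow_mul (by norm_num)]
  congr 1
  ring

/-- At `n = 2^m` the threshold is `k(n) = 2m`. -/
theorem kR_two_pow (m : ℕ) : kR (2 ^ m) = 2 * m := by
  change Nat.clog 2 ((2 ^ m) ^ 2) = 2 * m
  rw [← pow_mul, Nat.clog_pow _ _ one_lt_two]
  ring

theorem le_two_pow (m : ℕ) : m ≤ 2 ^ m := (Nat.lt_two_pow_self).le

/-- For every `ε > 0` and `n₀` there is `n = 2^m ≥ n₀` with `4 (n+1)² < n^{ε log₂ n}`. -/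
theorem exists_two_pow_quadratic_lt (ε : ℝ) (hε : 0 < ε) (n₀ : ℕ) :
    ∃ m : ℕ, n₀ ≤ 2 ^ m ∧ 3 ≤ m ∧
      4 * (((2 ^ m : ℕ) : ℝ) + 1) ^ 2 < ((2 ^ m : ℕ) : ℝ) ^ (ε * Real.logb 2 ((2 ^ m : ℕ) : ℝ)) := by
  refine ⟨max (max n₀ 3) ⌈5 / ε⌉₊, ?_, ?_, ?_⟩
  · exact le_trans (le_max_left _ _ |>.trans' (le_max_left _ _)) (le_two_pow _)
  · exact (le_max_right _ _).trans (le_max_left _ _)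
  · set m : ℕ := max (max n₀ 3) ⌈5 / ε⌉₊ with hm
    have hm3 : (3 : ℝ) ≤ m := by exact_mod_cast (le_max_right _ _).trans (le_max_left _ _)
    have hmε : 5 ≤ ε * m := by
      have h1 : (5 / ε : ℝ) ≤ m := (Nat.le_ceil _).trans (by exact_mod_cast le_max_right _ _)
      rw [div_le_iff₀ hε] at h1
      linarith
    rw [rpow_logb_two_pow]
    have hL : 4 * (((2 ^ m : ℕ) : ℝ) + 1) ^ 2 ≤ (2 : ℝ) ^ (((2 * m + 4 : ℕ)) : ℝ) := by
      rw [Real.rpow_natCast]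
      have h1 : ((2 ^ m : ℕ) : ℝ) + 1 ≤ (2 : ℝ) ^ (m + 1) := by
        have : (1 : ℝ) ≤ 2 ^ m := one_le_pow₀ (by norm_num)
        push_cast
        rw [pow_succ]
        linarith
      calc 4 * (((2 ^ m : ℕ) : ℝ) + 1) ^ 2 ≤ 4 * ((2 : ℝ) ^ (m + 1)) ^ 2 := by
            gcongr
        _ = (2 : ℝ) ^ (2 * m + 4) := by ring
    refine hL.trans_lt (Real.rpow_lt_rpow_of_exponent_lt (by norm_num) ?_)
    push_cast
    nlinarith

/-! ### The one-sided variants are false -/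

/-- The crux with the hypothesis on `π₂` DROPPED: "every resolution refutation of
`Clique(G, k(n))` alone is quasi-polynomially long, for every graph `G`". -/
def WithoutComplement : Prop :=
  ∃ ε : ℝ, 0 < ε ∧ ∃ n₀ : ℕ, ∀ n ≥ n₀, ∀ (G : SimpleGraph (Fin n)) [DecidableRel G.Adj],
    ∀ π : List (ResLine ℕ),
      IsResRefutation (cliqueCNF n (kR n) fun u v => decide (G.Adj u v)) π →
      (n : ℝ) ^ (ε * Real.logb 2 n) ≤ (π.length : ℝ)

/-- The crux with the hypothesis on `π₁` DROPPED: "every resolution refutation of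
`Clique(Ḡ, k(n))` alone is quasi-polynomially long, for every graph `G`". -/
def WithoutGraph : Prop :=
  ∃ ε : ℝ, 0 < ε ∧ ∃ n₀ : ℕ, ∀ n ≥ n₀, ∀ (G : SimpleGraph (Fin n)) [DecidableRel G.Adj],
    ∀ π : List (ResLine ℕ),
      IsResRefutation (cliqueCNF n (kR n) fun u v => decide (Gᶜ.Adj u v)) π →
      (n : ℝ) ^ (ε * Real.logb 2 n) ≤ (π.length : ℝ)

/-- **Any proof must use the refutation of the COMPLEMENT formula** (i.e. that `Ḡ` is
`K_k`-free too): the one-sided statement fails at the empty graph `G = ⊥`, whose clique formula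
has a `4(n+1)²`-line refutation while `n^{ε log₂ n}` is superpolynomial. -/
theorem resolutionUncertainty_false_without_complement : ¬ WithoutComplement := by
  rintro ⟨ε, hε, n₀, h⟩
  obtain ⟨m, hn₀, hm3, hlt⟩ := exists_two_pow_quadratic_lt ε hε n₀
  have hk : 2 ≤ kR (2 ^ m) := by rw [kR_two_pow]; omega
  obtain ⟨π, hπ, hlen⟩ := exists_refutation_of_noEdges hk
    (fun u v => decide ((⊥ : SimpleGraph (Fin (2 ^ m))).Adj u v)) (by simp)
  have hle := h (2 ^ m) hn₀ ⊥ π hπ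
  have hlen' : (π.length : ℝ) ≤ 4 * (((2 ^ m : ℕ) : ℝ) + 1) ^ 2 := by exact_mod_cast hlen
  linarith

/-- **Any proof must use the refutation of the GRAPH's own formula** (i.e. that `G` is
`K_k`-free too): the one-sided statement fails at the complete graph `G = ⊤` (`⊤ᶜ = ⊥`). -/
theorem resolutionUncertainty_false_without_graph : ¬ WithoutGraph := by
  rintro ⟨ε, hε, n₀, h⟩
  obtain ⟨m, hn₀, hm3, hlt⟩ := exists_two_pow_quadratic_lt ε hε n₀
  have hk : 2 ≤ kR (2 ^ m) := by rw [kR_two_pow]; omega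
  obtain ⟨π, hπ, hlen⟩ := exists_refutation_of_noEdges hk
    (fun u v => decide ((⊤ : SimpleGraph (Fin (2 ^ m)))ᶜ.Adj u v)) (by simp)
  have hle := h (2 ^ m) hn₀ ⊤ π hπ
  have hlen' : (π.length : ℝ) ≤ 4 * (((2 ^ m : ℕ) : ℝ) + 1) ^ 2 := by exact_mod_cast hlen
  linarith

/-! ## Tightness: the brute-force refutation, `4 (n+1)^{k+1}` lines for EVERY `K_k`-free graph

Consequently the crux can only hold with `ε ≤ 2 + o(1)` and the strengthening to ALL exponents
(`n^{ω(log n)}` hardness) is false as soon as Ramsey graphs exist (support item `RamseyAbundant`). -/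

section BruteForce

variable {n k : ℕ} (adj : Fin n → Fin n → Bool)

/-- A block assignment `s : Fin t → Fin n` is CONSISTENT if all cross pairs are adjacent (for a
loopless symmetric `adj`: an ordered `t`-clique). Satisfying assignments of `Clique(adj, k)` are
exactly the consistent `s : Fin k → Fin n`. -/
def Consistent {t : ℕ} (s : Fin t → Fin n) : Prop :=
  ∀ a b : Fin t, a ≠ b → adj (s a) (s b) = true

instance {t : ℕ} (s : Fin t → Fin n) : Decidable (Consistent adj s) := by
  unfold Consistent; infer_instance

theorem not_consistent_iff {t : ℕ} (s : Fin t → Fin n) :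
    ¬ Consistent adj s ↔ ∃ a b : Fin t, a ≠ b ∧ adj (s a) (s b) = false := by
  simp [Consistent]

/-- Consistency is inherited by restrictions to an initial segment of the blocks. -/
theorem Consistent.restrict {t t' : ℕ} (h : t' ≤ t) {s : Fin t → Fin n} (hs : Consistent adj s) :
    Consistent adj (fun i : Fin t' => s (Fin.castLE h i)) :=
  fun _ _ hab => hs _ _ fun e => hab (Fin.castLE_injective h e)

/-- The consistent block assignments of length `t` (`t! ·` the number of `t`-cliques). -/
def cons (t : ℕ) : Finset (Fin t → Fin n) :=
  Finset.univ.filter fun s => Consistent adj s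

theorem mem_cons {t : ℕ} {s : Fin t → Fin n} : s ∈ cons adj t ↔ Consistent adj s := by
  simp [cons]

theorem card_cons_le (t : ℕ) : (cons adj t).card ≤ n ^ t :=
  (Finset.card_filter_le _ _).trans (by simp)

theorem cons_eq_empty_of_forall {w t : ℕ} (hw : ∀ s : Fin (w + 1) → Fin n, ¬ Consistent adj s)
    (ht : w + 1 ≤ t) : cons adj t = ∅ :=
  Finset.filter_eq_empty_iff.2 fun _ _ hs => hw _ (hs.restrict adj ht)

/-- `N(s) = {¬x_{i, s i} : i < t}` for a block assignment `s : Fin t → Fin n`. -/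
def nCl (n : ℕ) {t : ℕ} (s : Fin t → Fin n) : Finset (Literal ℕ) :=
  Finset.univ.image fun i : Fin t => ((i : ℕ) * n + (s i : ℕ), false)

/-- `M(s, j) = N(s) ∪ {x_{t,w} : j ≤ w < n}`. -/
def mCl (n : ℕ) {t : ℕ} (s : Fin t → Fin n) (j : ℕ) : Finset (Literal ℕ) :=
  nCl n s ∪ (Finset.Ico j n).image fun w => (t * n + w, true)

theorem mCl_n {t : ℕ} (s : Fin t → Fin n) : mCl n s n = nCl n s := by
  simp [mCl]

/-- The block of level `t`: for every CONSISTENT `s : Fin t → Fin n`, the clauses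
`M(s,0), …, M(s,n)`. -/
noncomputable def blk (t : ℕ) : List (Finset (Literal ℕ)) :=
  (cons adj t).toList.flatMap fun s => (List.range (n + 1)).map (mCl n s)

theorem length_blk (t : ℕ) : (blk adj t).length = (cons adj t).card * (n + 1) := by
  rw [blk, List.length_flatMap]
  have : (fun s : Fin t → Fin n => ((List.range (n + 1)).map (mCl n s)).length) =
      fun _ => n + 1 := by
    funext s; simp
  rw [this, List.map_const', List.sum_replicate, smul_eq_mul, Finset.length_toList]

theorem mCl_mem_blk {t : ℕ} {s : Fin t → Fin n} (hs : Consistent adj s) {j : ℕ} (hj : j < n + 1) :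
    mCl n s j ∈ blk adj t :=
  List.mem_flatMap.2 ⟨s, Finset.mem_toList.2 ((mem_cons adj).2 hs),
    List.mem_map.2 ⟨j, List.mem_range.2 hj, rfl⟩⟩

/-- The whole clause list: levels `k, k-1, …, 0`. -/
noncomputable def bruteSteps (k : ℕ) : List (Finset (Literal ℕ)) :=
  (List.range (k + 1)).flatMap fun r => blk adj (k - r)

theorem empty_mem_bruteSteps : (∅ : Finset (Literal ℕ)) ∈ bruteSteps adj k := by
  refine List.mem_flatMap.2 ⟨k, List.mem_range.2 (Nat.lt_succ_self k), ?_⟩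
  rw [Nat.sub_self]
  have h := mCl_mem_blk adj (t := 0) (s := Fin.elim0) (fun a => a.elim0) (Nat.lt_succ_self n)
  rwa [mCl_n, show nCl n (Fin.elim0 : Fin 0 → Fin n) = ∅ by simp [nCl]] at h

theorem length_flatMap_le {α β : Type*} (l : List α) (g : α → List β) (B : ℕ)
    (h : ∀ x ∈ l, (g x).length ≤ B) : (l.flatMap g).length ≤ l.length * B := by
  induction l with
  | nil => simp
  | cons x l ih =>
    rw [List.flatMap_cons, List.length_append, List.length_cons, Nat.succ_mul]
    have h1 := h x (by simp)
    have h2 := ih fun y hy => h y (by simp [hy])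
    omega

/-- Crude count: at most `(k+1)(n+1)^{k+1}` clauses. -/
theorem length_bruteSteps_le : (bruteSteps adj k).length ≤ (k + 1) * (n + 1) ^ (k + 1) := by
  have h := length_flatMap_le (List.range (k + 1)) (fun r => blk adj (k - r)) ((n + 1) ^ (k + 1))
    fun r _ => by
      rw [length_blk, pow_succ]
      exact Nat.mul_le_mul_right _ ((card_cons_le adj _).trans
        ((Nat.pow_le_pow_left (Nat.le_succ n) _).trans
          (Nat.pow_le_pow_right (Nat.succ_pos n) (Nat.sub_le k r))))
  simpa [bruteSteps] using h

theorem bruteSteps_succ (k : ℕ) : bruteSteps adj (k + 1) = blk adj (k + 1) ++ bruteSteps adj k := by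
  unfold bruteSteps
  rw [List.range_succ_eq_map, List.flatMap_cons, Nat.sub_zero, List.flatMap_map]
  congr 1
  congr 1
  funext r
  simp

/-- Clique-number count: if no block assignment of length `w+1` is consistent (`ω < w+1`), the
list has at most `(w+1)(n+1)^{w+1}` clauses, WHATEVER `k` is. -/
theorem length_bruteSteps_le_of_cliqueNum {w : ℕ}
    (hw : ∀ s : Fin (w + 1) → Fin n, ¬ Consistent adj s) :
    ∀ k, (bruteSteps adj k).length ≤ (w + 1) * (n + 1) ^ (w + 1) := by
  intro k
  induction k with
  | zero =>
    refine (length_bruteSteps_le adj).trans ?_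
    exact Nat.mul_le_mul (by omega) (Nat.pow_le_pow_right (Nat.succ_pos n) (by omega))
  | succ k ih =>
    rcases Nat.lt_or_ge k w with hk | hk
    · refine (length_bruteSteps_le adj).trans ?_
      exact Nat.mul_le_mul (by omega) (Nat.pow_le_pow_right (Nat.succ_pos n) (by omega))
    · rw [bruteSteps_succ, List.length_append, length_blk,
        cons_eq_empty_of_forall adj hw (by omega), Finset.card_empty, zero_mul, zero_add]
      exact ih

theorem stepList_flatMap_of_forall {α : Type*} {A : Set (Finset (Literal ℕ))} {l : List α}
    {g : α → List (Finset (Literal ℕ))} (h : ∀ x ∈ l, StepList A (g x)) :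
    StepList A (l.flatMap g) := by
  induction l with
  | nil => simp
  | cons x l ih =>
    rw [List.flatMap_cons]
    exact StepList.append (h x (by simp)) ((ih fun y hy => h y (by simp [hy])).mono
      Set.subset_union_left)

/-- One level of the brute-force refutation is a step list over the axioms together with the
clauses `N(s')` of the CONSISTENT `s' : Fin (t+1) → Fin n` of the level above: `M(s,0)` weakens
the clique clause of block `t`; `M(s,j+1)` is the resolvent on `x_{t,j}` of `M(s,j)` with `N(s⌢j)`
when `s⌢j` is consistent (then `t+1 < k` by `K_k`-freeness) and with the edge axiom
`¬x_{i,s i} ∨ ¬x_{t,j}` of a non-adjacent pair otherwise. -/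
theorem stepList_blk (hfree : ∀ s : Fin k → Fin n, ¬ Consistent adj s) {t : ℕ} (ht : t ≤ k) :
    StepList (clauseSet (cliqueCNF n k adj) ∪
      {C | t < k ∧ ∃ s' : Fin (t + 1) → Fin n, Consistent adj s' ∧ C = nCl n s'}) (blk adj t) := by
  refine stepList_flatMap_of_forall fun s hs => stepList_map_range fun j hj => ?_
  have hsC : Consistent adj s := (mem_cons adj).1 (Finset.mem_toList.1 hs)
  rcases Nat.lt_or_ge t k with htk | htk
  swap
  · -- top level `t = k`: no consistent `s` exists
    have e : t = k := le_antisymm ht htk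
    subst e
    exact absurd hsC (hfree s)
  rcases j with _ | j
  · -- `M(s,0)` is a weakening of the clique-member clause of block `t`
    refine DerivStep.of_mem (Or.inl (Or.inl (mem_clauseSet_of_mem
      (clique_mem_cliqueCNF adj htk)))) ?_
    intro l hl
    obtain ⟨v, hv, rfl⟩ := List.mem_map.1 (List.mem_toFinset.1 hl)
    simp only [mCl, Finset.mem_union, Finset.mem_image, Finset.mem_Ico]
    exact Or.inr ⟨v, ⟨Nat.zero_le _, mem_coe_finRange_iff.1 hv⟩, rfl⟩
  · have hjn : j < n := by omega
    set s' : Fin (t + 1) → Fin n := Fin.snoc s ⟨j, hjn⟩ with hs'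
    -- the common subset facts
    have hD : (t * n + j, true) ∈ mCl n s j := by
      simp only [mCl, Finset.mem_union, Finset.mem_image, Finset.mem_Ico]
      exact Or.inr ⟨j, ⟨le_rfl, hjn⟩, rfl⟩
    have hDsub : (mCl n s j).erase (t * n + j, true) ⊆ mCl n s (j + 1) := by
      intro l hl
      simp only [mCl, Finset.mem_erase, Finset.mem_union, Finset.mem_image, Finset.mem_Ico]
        at hl ⊢
      obtain ⟨hne, hN | ⟨w, ⟨hjw, hwn⟩, rfl⟩⟩ := hl
      · exact Or.inl hN
      · refine Or.inr ⟨w, ⟨?_, hwn⟩, rfl⟩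
        rcases Nat.eq_or_lt_of_le hjw with rfl | h
        · exact absurd rfl hne
        · exact h
    have hNsub : ∀ i : Fin t, ((i : ℕ) * n + (s i : ℕ), false) ∈ mCl n s (j + 1) := fun i => by
      simp only [mCl, Finset.mem_union, nCl, Finset.mem_image, Finset.mem_univ, true_and]
      exact Or.inl ⟨i, rfl⟩
    by_cases hc : Consistent adj s'
    · -- resolve with `N(s')`, available from level `t+1 < k`
      have ht1 : t + 1 < k := by
        by_contra h1
        have e : t + 1 = k := by omega
        subst e
        exact hfree s' hc
      refine DerivStep.of_res (D := mCl n s j) (E := nCl n s') (v := t * n + j)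
        (Or.inr ⟨j, Nat.lt_succ_self j, rfl⟩) (Or.inl (Or.inr ⟨htk, s', hc, rfl⟩)) hD ?_ hDsub ?_
      · simp only [nCl, Finset.mem_image, Finset.mem_univ, true_and]
        exact ⟨Fin.last t, by simp [hs']⟩
      · intro l hl
        simp only [Finset.mem_erase, nCl, Finset.mem_image, Finset.mem_univ, true_and] at hl
        obtain ⟨hne, i, rfl⟩ := hl
        rcases Fin.eq_castSucc_or_eq_last i with ⟨i, rfl⟩ | rfl
        · simpa [hs'] using hNsub i
        · exact absurd (by simp [hs']) hne
    · -- resolve with the edge axiom of a non-adjacent pair, which must involve block `t`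
      obtain ⟨a, b, hab, hadj⟩ := (not_consistent_iff adj s').1 hc
      -- one of `a`, `b` is the new block `t`
      have key : ∃ i : Fin t, (adj (s i) ⟨j, hjn⟩ = false ∨ adj ⟨j, hjn⟩ (s i) = false) := by
        rcases Fin.eq_castSucc_or_eq_last a with ⟨a, rfl⟩ | rfl <;>
          rcases Fin.eq_castSucc_or_eq_last b with ⟨b, rfl⟩ | rfl
        · exfalso
          have := hsC a b fun e => hab (by rw [e])
          simp [hs'] at hadj
          simp [hadj] at this
        · exact ⟨a, Or.inl (by simpa [hs'] using hadj)⟩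
        · exact ⟨b, Or.inr (by simpa [hs'] using hadj)⟩
        · exact absurd rfl hab
      obtain ⟨i, hi⟩ := key
      have hit : (i : ℕ) ≠ t := Nat.ne_of_lt i.isLt
      -- the axiom as a finset, in either orientation
      have hax : ({((i : ℕ) * n + (s i : ℕ), false), (t * n + j, false)} : Finset (Literal ℕ)) ∈
          clauseSet (cliqueCNF n k adj) := by
        rcases hi with hi | hi
        · have := mem_clauseSet_of_mem (edge_mem_cliqueCNF (i.isLt.trans htk) htk hit hi)
          simpa using this
        · have := mem_clauseSet_of_mem (edge_mem_cliqueCNF htk (i.isLt.trans htk) hit.symm hi)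
          simp only [List.toFinset_cons, List.toFinset_nil, Finset.insert_empty] at this
          rwa [Finset.pair_comm] at this
      refine DerivStep.of_res (D := mCl n s j)
        (E := {((i : ℕ) * n + (s i : ℕ), false), (t * n + j, false)}) (v := t * n + j)
        (Or.inr ⟨j, Nat.lt_succ_self j, rfl⟩) (Or.inl (Or.inl hax)) hD (by simp) hDsub ?_
      intro l hl
      simp only [Finset.mem_erase, Finset.mem_insert, Finset.mem_singleton] at hl
      obtain ⟨hne, rfl | rfl⟩ := hl
      · exact hNsub i
      · exact absurd rfl hne

/-- The whole brute-force clause list is a step list from the axioms. -/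
theorem stepList_bruteSteps (hfree : ∀ s : Fin k → Fin n, ¬ Consistent adj s) :
    StepList (clauseSet (cliqueCNF n k adj)) (bruteSteps adj k) := by
  refine stepList_flatMap_range fun r hr => (stepList_blk adj hfree (Nat.sub_le k r)).mono ?_
  rintro C (hC | ⟨hlt, s', hs', rfl⟩)
  · exact Or.inl hC
  · refine Or.inr ⟨r - 1, by omega, ?_⟩
    have e : k - (r - 1) = k - r + 1 := by omega
    rw [e, ← mCl_n]
    exact mCl_mem_blk adj hs' (Nat.lt_succ_self n)

/-- **Tightness (brute force, clique-count form).** If no block assignment `Fin k → Fin n` is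
consistent (the formula is unsatisfiable), `Clique(adj, k)` has a resolution refutation with at
most `4 (n+1) Σ_{t ≤ k} C_t` lines, `C_t` = number of consistent `Fin t → Fin n` (= `t!` times
the number of `t`-cliques): the decision tree over block assignments read as a (tree-like,
regular) refutation. -/
theorem exists_refutation_le_length (hfree : ∀ s : Fin k → Fin n, ¬ Consistent adj s) :
    ∃ π : List (ResLine ℕ), IsResRefutation (cliqueCNF n k adj) π ∧
      π.length ≤ 4 * (bruteSteps adj k).length := by
  obtain ⟨π, hπ, hlen, hall⟩ := (stepList_bruteSteps adj hfree).exists_isResDerivation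
  obtain ⟨l, hl, hl0⟩ := hall ∅ (empty_mem_bruteSteps adj)
  exact ⟨π, ⟨hπ, l, hl, hl0⟩, hlen⟩

/-- The clause count in closed form: `(n+1) Σ_{t ≤ k} C_t`. -/
theorem length_bruteSteps_eq (k : ℕ) :
    (bruteSteps adj k).length = (n + 1) * ∑ t ∈ Finset.range (k + 1), (cons adj t).card := by
  induction k with
  | zero => simp [bruteSteps, length_blk, mul_comm]
  | succ k ih =>
    rw [bruteSteps_succ, List.length_append, ih, length_blk, Finset.sum_range_succ _ (k + 1)]
    ring

/-- **Tightness (clique-count form).** `≤ 4 (n+1) Σ_{t ≤ k} C_t` lines. -/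
theorem exists_refutation_le_count (hfree : ∀ s : Fin k → Fin n, ¬ Consistent adj s) :
    ∃ π : List (ResLine ℕ), IsResRefutation (cliqueCNF n k adj) π ∧
      π.length ≤ 4 * ((n + 1) * ∑ t ∈ Finset.range (k + 1), (cons adj t).card) := by
  obtain ⟨π, hπ, hlen⟩ := exists_refutation_le_length adj hfree
  exact ⟨π, hπ, by rwa [length_bruteSteps_eq] at hlen⟩

/-- **Tightness (brute force).** `≤ 4 (k+1) (n+1)^{k+1}` lines for every `adj` without a
consistent `k`-assignment. -/
theorem exists_refutation_le_pow (hfree : ∀ s : Fin k → Fin n, ¬ Consistent adj s) :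
    ∃ π : List (ResLine ℕ), IsResRefutation (cliqueCNF n k adj) π ∧
      π.length ≤ 4 * ((k + 1) * (n + 1) ^ (k + 1)) := by
  obtain ⟨π, hπ, hlen⟩ := exists_refutation_le_length adj hfree
  exact ⟨π, hπ, hlen.trans (Nat.mul_le_mul_left 4 (length_bruteSteps_le adj))⟩

/-- **Tightness governed by the clique number.** If moreover no `Fin (w+1) → Fin n` is consistent
(`ω(adj) ≤ w`), the refutation has at most `4 (w+1) (n+1)^{w+1}` lines — independently of `k`:
brute force costs `n^{ω + O(1)}`, not `n^{k}`. -/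
theorem exists_refutation_le_pow_cliqueNum (hfree : ∀ s : Fin k → Fin n, ¬ Consistent adj s)
    {w : ℕ} (hw : ∀ s : Fin (w + 1) → Fin n, ¬ Consistent adj s) :
    ∃ π : List (ResLine ℕ), IsResRefutation (cliqueCNF n k adj) π ∧
      π.length ≤ 4 * ((w + 1) * (n + 1) ^ (w + 1)) := by
  obtain ⟨π, hπ, hlen⟩ := exists_refutation_le_length adj hfree
  exact ⟨π, hπ, hlen.trans (Nat.mul_le_mul_left 4 (length_bruteSteps_le_of_cliqueNum adj hw k))⟩

end BruteForce

/-- `K_k`-freeness of a simple graph in the formula's terms: no block assignment is consistent. -/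
theorem cliqueFree_iff_forall_not_consistent {n k : ℕ} (G : SimpleGraph (Fin n)) [DecidableRel G.Adj] :
    G.CliqueFree k ↔ ∀ s : Fin k → Fin n, ¬ Consistent (fun u v => decide (G.Adj u v)) s := by
  constructor
  · intro h s hs
    have hadj : ∀ i j : Fin k, i ≠ j → G.Adj (s i) (s j) := fun i j hij => by
      simpa using hs i j hij
    have hinj : Function.Injective s := fun i j hij => by
      by_contra hne
      have h' := hadj i j hne
      rw [hij] at h'
      exact G.irrefl h'
    refine h (Finset.univ.image s) ⟨?_, ?_⟩
    · intro x hx y hy hxy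
      obtain ⟨i, -, rfl⟩ := Finset.mem_image.1 (Finset.mem_coe.1 hx)
      obtain ⟨j, -, rfl⟩ := Finset.mem_image.1 (Finset.mem_coe.1 hy)
      exact hadj i j fun hij => hxy (congrArg s hij)
    · rw [Finset.card_image_of_injective _ hinj, Finset.card_univ, Fintype.card_fin]
  · intro h t ht
    have hcard : t.card = k := ht.card_eq
    refine h (fun i => t.orderEmbOfFin hcard i) fun i j hij => ?_
    have hne : t.orderEmbOfFin hcard i ≠ t.orderEmbOfFin hcard j := fun e =>
      hij ((t.orderEmbOfFin hcard).injective e)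
    have : G.Adj (t.orderEmbOfFin hcard i) (t.orderEmbOfFin hcard j) :=
      ht.isClique (Finset.orderEmbOfFin_mem t hcard i) (Finset.orderEmbOfFin_mem t hcard j) hne
    simpa using this

/-- **Tightness at the crux's threshold.** For EVERY graph `G` on `n` vertices without a
`k(n)`-clique, `Clique(G, k(n))` has a refutation with at most `4 (n+1)^{k(n)+1}` =
`n^{(2+o(1)) log₂ n}` lines; so `ResolutionUncertainty` can only hold with `ε ≤ 2`. -/
theorem exists_refutation_at_threshold {n : ℕ} (G : SimpleGraph (Fin n)) [DecidableRel G.Adj]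
    (hG : G.CliqueFree (kR n)) :
    ∃ π : List (ResLine ℕ), IsResRefutation (cliqueCNF n (kR n) fun u v => decide (G.Adj u v)) π ∧
      π.length ≤ 4 * ((kR n + 1) * (n + 1) ^ (kR n + 1)) :=
  exists_refutation_le_pow _ ((cliqueFree_iff_forall_not_consistent G).1 hG)

/-- **Tightness at the threshold, clique-number form.** If `ω(G) ≤ w` (and `G` has no
`k(n)`-clique), `Clique(G, k(n))` has a refutation with at most `4 (w+1) (n+1)^{w+1}` lines: the
cost of certifying Ramsey-ness by brute force is `n^{ω(G) + O(1)}` on the `G`-side and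
`n^{α(G) + O(1)}` on the `Ḡ`-side; so the crux's `max` is at most `n^{min(ω,α) + O(1)}` — hardness
`n^{ε log₂ n}` can only come from graphs with BOTH `ω(G)` and `α(G)` at least `(ε - o(1)) log₂ n`
(which Ramsey graphs at the threshold do satisfy: `ω, α ≥ ½ log₂ n` by Erdős–Szekeres). -/
theorem exists_refutation_at_threshold_cliqueNum {n w : ℕ} (G : SimpleGraph (Fin n))
    [DecidableRel G.Adj] (hG : G.CliqueFree (kR n)) (hw : G.CliqueFree (w + 1)) :
    ∃ π : List (ResLine ℕ), IsResRefutation (cliqueCNF n (kR n) fun u v => decide (G.Adj u v)) π ∧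
      π.length ≤ 4 * ((w + 1) * (n + 1) ^ (w + 1)) :=
  exists_refutation_le_pow_cliqueNum _ ((cliqueFree_iff_forall_not_consistent G).1 hG)
    ((cliqueFree_iff_forall_not_consistent G).1 hw)

/-- The crux strengthened from SOME exponent `ε > 0` to EVERY exponent (`n^{ω(log n)}`
hardness of certifying Ramsey-ness in resolution). -/
def AllExponents : Prop :=
  ∀ ε : ℝ, 0 < ε → ∃ n₀ : ℕ, ∀ n ≥ n₀, ∀ (G : SimpleGraph (Fin n)) [DecidableRel G.Adj],
    ∀ π₁ π₂ : List (ResLine ℕ),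
      IsResRefutation (cliqueCNF n (kR n) fun u v => decide (G.Adj u v)) π₁ →
      IsResRefutation (cliqueCNF n (kR n) fun u v => decide (Gᶜ.Adj u v)) π₂ →
      (n : ℝ) ^ (ε * Real.logb 2 n) ≤ max (π₁.length : ℝ) (π₂.length : ℝ)

/-- Pure arithmetic: `4 (2m+1) (2^m + 1)^{2m+1} < 2^{4m²}` for `m ≥ 3`. -/
theorem four_mul_pow_lt (m : ℕ) (hm : 3 ≤ m) :
    4 * ((2 * m + 1) * (2 ^ m + 1) ^ (2 * m + 1)) < 2 ^ (4 * m * m) := by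
  have h0 : m < 2 ^ m := Nat.lt_two_pow_self
  have h1 : (2 ^ m + 1) ^ (2 * m + 1) ≤ (2 ^ (m + 1)) ^ (2 * m + 1) :=
    Nat.pow_le_pow_left (by rw [pow_succ]; omega) _
  have h1' : 2 * m + 1 ≤ 2 ^ (m + 1) := by rw [pow_succ]; omega
  have h2 : 4 * (2 ^ (m + 1) * (2 ^ (m + 1)) ^ (2 * m + 1)) =
      2 ^ (2 + (m + 1) + (m + 1) * (2 * m + 1)) := by
    rw [← pow_mul, pow_add, pow_add]; ring
  have h3 : 2 + (m + 1) + (m + 1) * (2 * m + 1) < 4 * m * m := by nlinarith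
  calc 4 * ((2 * m + 1) * (2 ^ m + 1) ^ (2 * m + 1))
      ≤ 4 * (2 ^ (m + 1) * (2 ^ (m + 1)) ^ (2 * m + 1)) :=
        Nat.mul_le_mul_left 4 (Nat.mul_le_mul h1' h1)
    _ = 2 ^ (2 + (m + 1) + (m + 1) * (2 * m + 1)) := h2
    _ < 2 ^ (4 * m * m) := Nat.pow_lt_pow_right (by norm_num) h3

/-- **The all-exponents strengthening is false, given Ramsey graphs** (support item
`RamseyAbundant`, Erdős 1947): at `n = 2^m` a Ramsey graph has both clique formulas refuted in
`4(n+1)^{2m+1} < 2^{4m²} = n^{4 log₂ n}` lines. -/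
theorem not_allExponents (hR : RamseyAbundant) : ¬ AllExponents := by
  intro h
  obtain ⟨n₀, hn⟩ := h 4 (by norm_num)
  set m : ℕ := max n₀ 3 with hm
  have hm3 : 3 ≤ m := le_max_right _ _
  have hn₀ : n₀ ≤ 2 ^ m := (le_max_left _ _).trans (le_two_pow m)
  have h3 : 3 ≤ 2 ^ m := hm3.trans (le_two_pow m)
  obtain ⟨G, hG, hGc⟩ := hR (2 ^ m) h3
  classical
  obtain ⟨π₁, hπ₁, hl₁⟩ := exists_refutation_at_threshold G hG
  obtain ⟨π₂, hπ₂, hl₂⟩ := exists_refutation_at_threshold Gᶜ hGc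
  have hle := hn (2 ^ m) hn₀ G π₁ π₂ hπ₁ hπ₂
  rw [rpow_logb_two_pow] at hle
  rw [kR_two_pow] at hl₁ hl₂
  have hlt := four_mul_pow_lt m hm3
  have hcast : (2 : ℝ) ^ ((4 : ℝ) * m * m) = ((2 ^ (4 * m * m) : ℕ) : ℝ) := by
    rw [Nat.cast_pow, Nat.cast_ofNat, ← Real.rpow_natCast]
    congr 1
    push_cast
    ring
  rw [hcast] at hle
  have h1 : (π₁.length : ℝ) < ((2 ^ (4 * m * m) : ℕ) : ℝ) := by exact_mod_cast hl₁.trans_lt hlt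
  have h2 : (π₂.length : ℝ) < ((2 ^ (4 * m * m) : ℕ) : ℝ) := by exact_mod_cast hl₂.trans_lt hlt
  exact absurd hle (not_le.2 (max_lt h1 h2))


/-! ## Ramsey graphs exist at the threshold (support item `RamseyAbundant`, Erdős 1947)

Needed to make the strengthening-refutations unconditional; derived from the tree's
`Literature.Combinatorics.SimpleGraph.erdos1947_ramsey_lower_holds` (`C(n,k) 2^{1-C(k,2)} < 1 ⇒` a
graph on `n` vertices with no `k`-clique and no `k`-independent set) by the threshold arithmetic
`(k!)² > 2^{k+2}` (`k ≥ 3`) and `n² ≤ 2^k`. -/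

theorem factorial_sq_gt (k : ℕ) (hk : 3 ≤ k) : 2 ^ (k + 2) < k.factorial ^ 2 := by
  induction k with
  | zero => omega
  | succ k ih =>
    rcases Nat.lt_or_ge k 3 with h | h
    · obtain rfl : k = 2 := by omega
      decide
    · have ih' := ih h
      have h4 : 2 ≤ (k + 1) ^ 2 := by nlinarith
      calc 2 ^ (k + 1 + 2) = 2 * 2 ^ (k + 2) := by ring
        _ < 2 * k.factorial ^ 2 := by omega
        _ ≤ (k + 1) ^ 2 * k.factorial ^ 2 := Nat.mul_le_mul_right _ h4
        _ = (k + 1).factorial ^ 2 := by rw [Nat.factorial_succ]; ring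

theorem two_mul_choose_lt (n k : ℕ) (hk : 3 ≤ k) (hn : n ^ 2 ≤ 2 ^ k) :
    2 * n.choose k < 2 ^ k.choose 2 := by
  have hc : 2 * k.choose 2 = k * (k - 1) := by
    rw [Nat.choose_two_right]
    exact Nat.mul_div_cancel' (Nat.even_mul_pred_self k).two_dvd
  have hkk : k * (k - 1) + k = k * k := by
    have : k - 1 + 1 = k := by omega
    calc k * (k - 1) + k = k * (k - 1 + 1) := by ring
      _ = k * k := by rw [this]
  have h1 : k.factorial * n.choose k ≤ n ^ k := by
    rw [← Nat.descFactorial_eq_factorial_mul_choose]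
    exact Nat.descFactorial_le_pow n k
  have h2 : (n ^ k) ^ 2 ≤ 2 ^ (k * k) := by
    rw [← pow_mul, mul_comm, pow_mul, pow_mul]
    exact Nat.pow_le_pow_left hn k
  have hpos : 0 < k.factorial ^ 2 := by positivity
  have key : k.factorial ^ 2 * (2 * n.choose k) ^ 2 < k.factorial ^ 2 * (2 ^ k.choose 2) ^ 2 := by
    calc k.factorial ^ 2 * (2 * n.choose k) ^ 2 = 4 * (k.factorial * n.choose k) ^ 2 := by ring
      _ ≤ 4 * (n ^ k) ^ 2 := by gcongr
      _ ≤ 4 * 2 ^ (k * k) := by gcongr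
      _ = 2 ^ (k + 2) * 2 ^ (k * (k - 1)) := by rw [← hkk]; ring
      _ < k.factorial ^ 2 * 2 ^ (k * (k - 1)) :=
          Nat.mul_lt_mul_of_pos_right (factorial_sq_gt k hk) (by positivity)
      _ = k.factorial ^ 2 * (2 ^ k.choose 2) ^ 2 := by rw [← pow_mul, ← hc]; ring
  have key' : (2 * n.choose k) ^ 2 < (2 ^ k.choose 2) ^ 2 := Nat.lt_of_mul_lt_mul_left key
  exact lt_of_pow_lt_pow_left₀ 2 (Nat.zero_le _) key'

theorem erdos_condition (n k : ℕ) (hk : 3 ≤ k) (hn : n ^ 2 ≤ 2 ^ k) :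
    (n.choose k : ℝ) * (2 : ℝ) ^ ((1 : ℝ) - (k.choose 2 : ℝ)) < 1 := by
  have h := two_mul_choose_lt n k hk hn
  have hR : (2 * n.choose k : ℝ) < (2 : ℝ) ^ k.choose 2 := by exact_mod_cast h
  rw [Real.rpow_sub (by norm_num : (0 : ℝ) < 2), Real.rpow_one, Real.rpow_natCast,
    mul_div_assoc', div_lt_one (by positivity)]
  linarith

/-- **`RamseyAbundant` holds** (route support item `stmt-PneNP-9821`): for every `n ≥ 3` some graph
on `Fin n` has neither a clique nor an independent set of size `k(n) = ⌈log₂ n²⌉`. -/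
theorem ramseyAbundant_holds : RamseyAbundant := by
  intro n hn
  refine Literature.Combinatorics.SimpleGraph.erdos1947_ramsey_lower_holds n _
    (erdos_condition n _ ?_ (Nat.le_pow_clog one_lt_two _))
  calc 3 ≤ Nat.clog 2 (3 ^ 2) := by decide
    _ ≤ Nat.clog 2 (n ^ 2) := Nat.clog_mono_right 2 (Nat.pow_le_pow_left hn 2)

/-- Hence the all-exponents strengthening is false outright. -/
theorem not_allExponents' : ¬ AllExponents :=
  not_allExponents ramseyAbundant_holds

/-- **Non-vacuity.** From `n = 3` on, the crux's hypotheses are satisfiable: some graph `G` on `Fin n`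
admits resolution refutations of BOTH clique formulas at the threshold (so the universal
quantification over `π₁, π₂` is never vacuous, and a proof must really bound lengths). -/
theorem hypotheses_satisfiable (n : ℕ) (hn : 3 ≤ n) :
    ∃ (G : SimpleGraph (Fin n)) (_ : DecidableRel G.Adj) (π₁ π₂ : List (ResLine ℕ)),
      IsResRefutation (cliqueCNF n (kR n) fun u v => decide (G.Adj u v)) π₁ ∧
      IsResRefutation (cliqueCNF n (kR n) fun u v => decide (Gᶜ.Adj u v)) π₂ := by
  classical
  obtain ⟨G, hG, hGc⟩ := ramseyAbundant_holds n hn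
  obtain ⟨π₁, hπ₁, -⟩ := exists_refutation_at_threshold G hG
  obtain ⟨π₂, hπ₂, -⟩ := exists_refutation_at_threshold Gᶜ hGc
  exact ⟨G, inferInstance, π₁, π₂, hπ₁, hπ₂⟩

/-! ## The exponent is at most 2

`ResolutionUncertaintyWith ε` is the crux at a fixed exponent; the crux is `∃ ε > 0, … With ε`.
Brute force shows no `ε > 2` can work. -/

/-- The crux at a FIXED exponent `ε`. -/
def ResolutionUncertaintyWith (ε : ℝ) : Prop :=
  ∃ n₀ : ℕ, ∀ n ≥ n₀, ∀ (G : SimpleGraph (Fin n)) [DecidableRel G.Adj],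
    ∀ π₁ π₂ : List (ResLine ℕ),
      IsResRefutation (cliqueCNF n (kR n) fun u v => decide (G.Adj u v)) π₁ →
      IsResRefutation (cliqueCNF n (kR n) fun u v => decide (Gᶜ.Adj u v)) π₂ →
      (n : ℝ) ^ (ε * Real.logb 2 n) ≤ max (π₁.length : ℝ) (π₂.length : ℝ)

theorem resolutionUncertainty_iff_exists_with :
    ResolutionUncertainty ↔ ∃ ε : ℝ, 0 < ε ∧ ResolutionUncertaintyWith ε := Iff.rfl

/-- Real form of the brute-force count at `n = 2^m`: `4 (2m+1) (2^m+1)^{2m+1} ≤ 2^{2m² + 4m + 4}`. -/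
theorem bruteForce_bound_real (m : ℕ) (hm : 1 ≤ m) :
    (4 * ((2 * m + 1) * (2 ^ m + 1) ^ (2 * m + 1)) : ℝ) ≤ (2 : ℝ) ^ ((2 * m * m + 4 * m + 4 : ℕ) : ℝ) := by
  rw [Real.rpow_natCast]
  have h0 : m < 2 ^ m := Nat.lt_two_pow_self
  have h1 : (2 ^ m + 1) ^ (2 * m + 1) ≤ (2 ^ (m + 1)) ^ (2 * m + 1) :=
    Nat.pow_le_pow_left (by rw [pow_succ]; omega) _
  have h1' : 2 * m + 1 ≤ 2 ^ (m + 1) := by rw [pow_succ]; omega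
  have h2 : 4 * (2 ^ (m + 1) * (2 ^ (m + 1)) ^ (2 * m + 1)) = 2 ^ (2 * m * m + 4 * m + 4) := by
    rw [← pow_mul, show 4 = 2 ^ 2 by norm_num, ← pow_add, ← pow_add]
    congr 1; ring
  have h : 4 * ((2 * m + 1) * (2 ^ m + 1) ^ (2 * m + 1)) ≤ 2 ^ (2 * m * m + 4 * m + 4) := by
    calc 4 * ((2 * m + 1) * (2 ^ m + 1) ^ (2 * m + 1))
        ≤ 4 * (2 ^ (m + 1) * (2 ^ (m + 1)) ^ (2 * m + 1)) :=
          Nat.mul_le_mul_left 4 (Nat.mul_le_mul h1' h1)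
      _ = 2 ^ (2 * m * m + 4 * m + 4) := h2
  exact_mod_cast h

/-- **Boundary lemma: the crux forces `ε ≤ 2`.** If `ResolutionUncertaintyWith ε` then `ε ≤ 2`
(Ramsey graphs at `n = 2^m` have both clique formulas refuted by brute force in
`2^{2m² + O(m)} = n^{(2 + o(1)) log₂ n}` lines). The conjectured truth (LPRT, binary encoding) is
`ε = Ω(1)` small; random-like Ramsey graphs even give brute-force size `n^{(1/2 + o(1)) log₂ n}`. -/
theorem eps_le_two_of_with {ε : ℝ} (h : ResolutionUncertaintyWith ε) : ε ≤ 2 := by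
  refine le_of_not_gt fun hε => ?_
  obtain ⟨n₀, hn⟩ := h
  -- choose `m` with `2^m ≥ n₀`, `m ≥ 3` and `(ε - 2) m ≥ 10`
  set m : ℕ := max (max n₀ 3) ⌈10 / (ε - 2)⌉₊ with hm
  have hm3 : 3 ≤ m := (le_max_right _ _).trans (le_max_left _ _)
  have hn₀ : n₀ ≤ 2 ^ m := ((le_max_left _ _).trans (le_max_left _ _)).trans (le_two_pow m)
  have hmε : 10 ≤ (ε - 2) * m := by
    have hpos : 0 < ε - 2 := by linarith
    have h1 : (10 / (ε - 2) : ℝ) ≤ m := (Nat.le_ceil _).trans (by exact_mod_cast le_max_right _ _)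
    rw [div_le_iff₀ hpos] at h1
    linarith
  obtain ⟨G, hG, hGc⟩ := ramseyAbundant_holds (2 ^ m) (hm3.trans (le_two_pow m))
  classical
  obtain ⟨π₁, hπ₁, hl₁⟩ := exists_refutation_at_threshold G hG
  obtain ⟨π₂, hπ₂, hl₂⟩ := exists_refutation_at_threshold Gᶜ hGc
  have hle := hn (2 ^ m) hn₀ G π₁ π₂ hπ₁ hπ₂
  rw [rpow_logb_two_pow] at hle
  rw [kR_two_pow] at hl₁ hl₂
  have hB := bruteForce_bound_real m (by omega)
  have h1 : (π₁.length : ℝ) ≤ (2 : ℝ) ^ ((2 * m * m + 4 * m + 4 : ℕ) : ℝ) :=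
    le_trans (by exact_mod_cast hl₁) hB
  have h2 : (π₂.length : ℝ) ≤ (2 : ℝ) ^ ((2 * m * m + 4 * m + 4 : ℕ) : ℝ) :=
    le_trans (by exact_mod_cast hl₂) hB
  have hmax : max (π₁.length : ℝ) (π₂.length : ℝ) ≤ (2 : ℝ) ^ ((2 * m * m + 4 * m + 4 : ℕ) : ℝ) :=
    max_le h1 h2
  have hexp : ((2 * m * m + 4 * m + 4 : ℕ) : ℝ) < ε * m * m := by
    have hm3' : (3 : ℝ) ≤ m := by exact_mod_cast hm3
    push_cast
    nlinarith
  have hlt := Real.rpow_lt_rpow_of_exponent_lt (by norm_num : (1 : ℝ) < 2) hexp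
  linarith

/-- In particular no exponent `ε > 2` works. -/
theorem not_resolutionUncertaintyWith_of_two_lt {ε : ℝ} (hε : 2 < ε) :
    ¬ ResolutionUncertaintyWith ε := fun h => (not_le.2 hε) (eps_le_two_of_with h)


/-! ## Random-like Ramsey graphs: both clique formulas refutable in `n^{(1/2+o(1)) log₂ n}` lines

Erdős's count refined by a first-moment bound on the number of consistent block assignments
(ordered cliques / independent sets): some graph on `Fin n` is Ramsey at `k` AND has
`2^{C(t,2)} C_t ≤ 8(k+1) n^t` consistent `t`-assignments on both sides for all `t ≤ k`. With the
clique-count form of brute force this gives refutations of length `2^{m²/2 + O(m)}` at `n = 2^m`,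
whence `ε ≤ 1/2` in the crux. -/

section Counting

open Finset

variable {n : ℕ}

/-- Adjacency (polarity `b = true`) / non-adjacency (`b = false`) in the graph with edge set `E`
(diagonal pairs inert). -/
def adjP (b : Bool) (E : Finset (Sym2 (Fin n))) (u v : Fin n) : Bool :=
  decide ((s(u, v) ∈ E ↔ b = true) ∧ u ≠ v)

/-- The graph with edge set `E`. -/
def gr (E : Finset (Sym2 (Fin n))) : SimpleGraph (Fin n) :=
  SimpleGraph.fromEdgeSet (↑E : Set (Sym2 (Fin n)))

instance (E : Finset (Sym2 (Fin n))) : DecidableRel (gr E).Adj := by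
  unfold gr; infer_instance

theorem decide_gr_adj (E : Finset (Sym2 (Fin n))) [DecidableRel (gr E).Adj] :
    (fun u v => decide ((gr E).Adj u v)) = adjP true E := by
  funext u v
  rw [adjP, Bool.eq_iff_iff]
  simp [gr, SimpleGraph.fromEdgeSet_adj]

theorem decide_gr_compl_adj (E : Finset (Sym2 (Fin n))) [DecidableRel (gr E).Adj] :
    (fun u v => decide ((gr E)ᶜ.Adj u v)) = adjP false E := by
  funext u v
  rw [adjP, Bool.eq_iff_iff]
  simp only [SimpleGraph.compl_adj, gr, SimpleGraph.fromEdgeSet_adj, Finset.mem_coe,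
    decide_eq_true_eq, Bool.false_eq_true, iff_false, ne_eq]
  tauto

/-- The `C(t,2)` pairs inside the image of a block assignment. -/
def pairsOf {t : ℕ} (s : Fin t → Fin n) : Finset (Sym2 (Fin n)) :=
  ((univ : Finset (Fin t)).image s).offDiag.image (Function.uncurry Sym2.mk)

theorem card_pairsOf {t : ℕ} {s : Fin t → Fin n} (hs : Function.Injective s) :
    (pairsOf s).card = t.choose 2 := by
  rw [pairsOf, Sym2.card_image_offDiag, card_image_of_injective _ hs, card_univ, Fintype.card_fin]

theorem injective_of_consistent {b : Bool} {t : ℕ} {s : Fin t → Fin n} {E : Finset (Sym2 (Fin n))}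
    (h : Consistent (adjP b E) s) : Function.Injective s := by
  intro a c hac
  by_contra hne
  have := h a c hne
  simp [adjP, hac] at this

theorem pairsOf_subset_or_disjoint {b : Bool} {t : ℕ} {s : Fin t → Fin n}
    {E : Finset (Sym2 (Fin n))} (h : Consistent (adjP b E) s) :
    pairsOf s ⊆ E ∨ Disjoint (pairsOf s) E := by
  have key : ∀ e ∈ pairsOf s, (e ∈ E ↔ b = true) := by
    intro e he
    simp only [pairsOf, mem_image, mem_offDiag, mem_univ, true_and, Prod.exists,
      Function.uncurry_apply_pair] at he
    obtain ⟨x, y, ⟨⟨a, rfl⟩, ⟨c, rfl⟩, hne⟩, rfl⟩ := he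
    have hac : a ≠ c := fun e => hne (by rw [e])
    have := h a c hac
    simp only [adjP, decide_eq_true_eq] at this
    exact this.1
  cases b
  · exact Or.inr (disjoint_left.2 fun e he heE => by simpa using (key e he).1 heE)
  · exact Or.inl fun e he => (key e he).2 rfl

/-- For a fixed block assignment `s`, at most `2 · 2^{N - C(t,2)}` edge sets make `s` consistent
(as cliques for `b = true`, as independent sets for `b = false`). -/
theorem card_filter_consistent_le (b : Bool) {t : ℕ} (s : Fin t → Fin n) :
    ((univ : Finset (Sym2 (Fin n))).powerset.filter fun E => Consistent (adjP b E) s).card ≤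
      2 * 2 ^ ((univ : Finset (Sym2 (Fin n))).card - t.choose 2) := by
  by_cases hs : Function.Injective s
  · rw [← card_pairsOf hs]
    refine le_trans (card_le_card ?_) ((card_union_le _ _).trans
      (Literature.Combinatorics.SimpleGraph.card_filter_superset_add_card_filter_disjoint_le
        univ (pairsOf s) (subset_univ _)))
    intro E hE
    rw [mem_filter] at hE
    rw [mem_union, mem_filter, mem_filter]
    rcases pairsOf_subset_or_disjoint hE.2 with h | h
    · exact Or.inl ⟨hE.1, h⟩
    · exact Or.inr ⟨hE.1, h⟩
  · have : ((univ : Finset (Sym2 (Fin n))).powerset.filter fun E => Consistent (adjP b E) s) = ∅ :=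
      filter_eq_empty_iff.2 fun E _ hE => hs (injective_of_consistent hE)
    rw [this, card_empty]
    exact Nat.zero_le _

/-- Double counting: `Σ_E C_t(E) ≤ n^t · 2 · 2^{N - C(t,2)}`. -/
theorem sum_card_cons_le (b : Bool) (t : ℕ) :
    ∑ E ∈ (univ : Finset (Sym2 (Fin n))).powerset, (cons (adjP b E) t).card ≤
      n ^ t * (2 * 2 ^ ((univ : Finset (Sym2 (Fin n))).card - t.choose 2)) := by
  calc ∑ E ∈ (univ : Finset (Sym2 (Fin n))).powerset, (cons (adjP b E) t).card
      = ∑ E ∈ (univ : Finset (Sym2 (Fin n))).powerset, ∑ s : Fin t → Fin n,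
          (if Consistent (adjP b E) s then 1 else 0) := by
        refine sum_congr rfl fun E _ => ?_
        rw [cons, card_filter]
    _ = ∑ s : Fin t → Fin n, ∑ E ∈ (univ : Finset (Sym2 (Fin n))).powerset,
          (if Consistent (adjP b E) s then 1 else 0) := sum_comm
    _ = ∑ s : Fin t → Fin n,
          ((univ : Finset (Sym2 (Fin n))).powerset.filter fun E => Consistent (adjP b E) s).card := by
        refine sum_congr rfl fun s _ => ?_
        rw [card_filter]
    _ ≤ ∑ _s : Fin t → Fin n, 2 * 2 ^ ((univ : Finset (Sym2 (Fin n))).card - t.choose 2) :=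
        sum_le_sum fun s _ => card_filter_consistent_le b s
    _ = n ^ t * (2 * 2 ^ ((univ : Finset (Sym2 (Fin n))).card - t.choose 2)) := by
        rw [sum_const, card_univ, smul_eq_mul, Fintype.card_fun, Fintype.card_fin, Fintype.card_fin]

/-- Markov's inequality, finitary. -/
theorem card_filter_lt_mul_le {ι : Type*} (S : Finset ι) (f : ι → ℕ) (A : ℕ) :
    (S.filter fun i => A < f i).card * A ≤ ∑ i ∈ S, f i := by
  calc (S.filter fun i => A < f i).card * A = ∑ _i ∈ S.filter (fun i => A < f i), A := by
        rw [sum_const, smul_eq_mul]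
    _ ≤ ∑ i ∈ S.filter (fun i => A < f i), f i := sum_le_sum fun i hi => (mem_filter.1 hi).2.le
    _ ≤ ∑ i ∈ S, f i := sum_le_sum_of_subset (filter_subset _ _)

/-- The edge sets with too many consistent `t`-assignments are few:
`4(k+1) · #bad_t ≤ 2^N`. -/
theorem card_bad_le (b : Bool) (k t : ℕ) (ht : t.choose 2 ≤ (univ : Finset (Sym2 (Fin n))).card)
    (hn : 0 < n) :
    4 * (k + 1) * ((univ : Finset (Sym2 (Fin n))).powerset.filter fun E =>
        8 * (k + 1) * n ^ t < 2 ^ t.choose 2 * (cons (adjP b E) t).card).card ≤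
      2 ^ (univ : Finset (Sym2 (Fin n))).card := by
  set U := (univ : Finset (Sym2 (Fin n))) with hU
  have h1 := card_filter_lt_mul_le U.powerset (fun E => 2 ^ t.choose 2 * (cons (adjP b E) t).card)
    (8 * (k + 1) * n ^ t)
  have h2 : ∑ E ∈ U.powerset, 2 ^ t.choose 2 * (cons (adjP b E) t).card ≤
      2 ^ t.choose 2 * (n ^ t * (2 * 2 ^ (U.card - t.choose 2))) := by
    rw [← mul_sum]
    exact Nat.mul_le_mul_left _ (sum_card_cons_le b t)
  have h3 : 2 ^ t.choose 2 * (n ^ t * (2 * 2 ^ (U.card - t.choose 2))) = 2 ^ U.card * (2 * n ^ t) := by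
    rw [show 2 ^ U.card = 2 ^ t.choose 2 * 2 ^ (U.card - t.choose 2) by
      rw [← pow_add, Nat.add_sub_cancel' ht]]
    ring
  have hpos : 0 < 2 * n ^ t := by positivity
  refine Nat.le_of_mul_le_mul_right ?_ hpos
  calc 4 * (k + 1) * (U.powerset.filter fun E =>
          8 * (k + 1) * n ^ t < 2 ^ t.choose 2 * (cons (adjP b E) t).card).card * (2 * n ^ t)
      = (U.powerset.filter fun E =>
          8 * (k + 1) * n ^ t < 2 ^ t.choose 2 * (cons (adjP b E) t).card).card *
          (8 * (k + 1) * n ^ t) := by ring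
    _ ≤ _ := h1
    _ ≤ _ := h2
    _ = 2 ^ U.card * (2 * n ^ t) := h3

/-- The edge sets whose graph has a homogeneous `k`-set number at most `C(n,k) · 2 · 2^{N-C(k,2)}`
(the count inside the tree's `erdos1947_ramsey_lower_holds`, for an arbitrary decidable `P`
implying homogeneity). -/
theorem card_filter_homogeneous_le (k : ℕ) (P : Finset (Sym2 (Fin n)) → Prop) [DecidablePred P]
    (hP : ∀ E, P E → ∃ S : Finset (Fin n), (gr E).IsNClique k S ∨ (gr E)ᶜ.IsNClique k S) :
    ((univ : Finset (Sym2 (Fin n))).powerset.filter P).card ≤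
      n.choose k * (2 * 2 ^ ((univ : Finset (Sym2 (Fin n))).card - k.choose 2)) := by
  set U := (univ : Finset (Sym2 (Fin n))) with hU
  set T : Finset (Fin n) → Finset (Sym2 (Fin n)) :=
    fun S => S.offDiag.image (Function.uncurry Sym2.mk) with hT
  have hcover : U.powerset.filter P ⊆
      ((univ : Finset (Fin n)).powersetCard k).biUnion fun S =>
        (U.powerset.filter fun E => T S ⊆ E) ∪ (U.powerset.filter fun E => Disjoint (T S) E) := by
    intro E hE
    rw [mem_filter] at hE
    obtain ⟨S, hS⟩ := hP E hE.2
    have hSk : S.card = k := by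
      rcases hS with hS | hS
      · exact hS.card_eq
      · exact hS.card_eq
    rw [mem_biUnion]
    refine ⟨S, mem_powersetCard.mpr ⟨subset_univ _, hSk⟩, ?_⟩
    rw [mem_union, mem_filter, mem_filter]
    rcases Literature.Combinatorics.SimpleGraph.pairs_subset_or_disjoint_of_homogeneous E S hS
      with h | h
    · exact Or.inl ⟨hE.1, h⟩
    · exact Or.inr ⟨hE.1, h⟩
  refine (card_le_card hcover).trans (card_biUnion_le.trans ?_)
  have hnk : ((univ : Finset (Fin n)).powersetCard k).card = n.choose k := by
    rw [card_powersetCard, card_univ, Fintype.card_fin]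
  rw [← hnk, ← smul_eq_mul, ← sum_const]
  refine sum_le_sum fun S hS => ?_
  have hTS : (T S).card = k.choose 2 := by
    rw [hT, Sym2.card_image_offDiag, (mem_powersetCard.mp hS).2]
  rw [← hTS]
  exact (card_union_le _ _).trans
    (Literature.Combinatorics.SimpleGraph.card_filter_superset_add_card_filter_disjoint_le _ (T S)
      (subset_univ _))

/-- **Ramsey graphs with few cliques and few independent sets.** If `4 C(n,k) < 2^{C(k,2)}`
(`k ≤ n + 1`, `n ≥ 1`), some graph on `Fin n` has no homogeneous `k`-set and, for every `t ≤ k`,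
at most `8(k+1) n^t / 2^{C(t,2)}` consistent block assignments of length `t` on either side. -/
theorem exists_ramsey_few_cliques (k : ℕ) (hn : 0 < n) (hk : k ≤ n + 1)
    (hnum : 4 * n.choose k < 2 ^ k.choose 2) :
    ∃ E : Finset (Sym2 (Fin n)), ((gr E).CliqueFree k ∧ (gr E)ᶜ.CliqueFree k) ∧
      ∀ b : Bool, ∀ t ≤ k, 2 ^ t.choose 2 * (cons (adjP b E) t).card ≤ 8 * (k + 1) * n ^ t := by
  classical
  set U := (univ : Finset (Sym2 (Fin n))) with hU
  have hUcard : U.card = (n + 1).choose 2 := by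
    rw [hU, card_univ, Sym2.card, Fintype.card_fin]
  have hkN : k.choose 2 ≤ U.card := hUcard ▸ Nat.choose_le_choose 2 hk
  -- the bad families
  set nonR := U.powerset.filter fun E => ¬ ((gr E).CliqueFree k ∧ (gr E)ᶜ.CliqueFree k) with hnonR
  set bad : Bool → ℕ → Finset (Finset (Sym2 (Fin n))) := fun b t =>
    U.powerset.filter fun E => 8 * (k + 1) * n ^ t < 2 ^ t.choose 2 * (cons (adjP b E) t).card
    with hbad
  set Bad := nonR ∪ (range (k + 1)).biUnion fun t => bad true t ∪ bad false t with hBad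
  -- counts
  have h1 : 4 * nonR.card < 2 * 2 ^ U.card := by
    have hc := card_filter_homogeneous_le (n := n) k
      (fun E => ¬ ((gr E).CliqueFree k ∧ (gr E)ᶜ.CliqueFree k)) (fun E hE => by
        by_cases hc : (gr E).CliqueFree k
        · have h' : ¬ (gr E)ᶜ.CliqueFree k := fun h'' => hE ⟨hc, h''⟩
          simp only [SimpleGraph.CliqueFree, not_forall, not_not] at h'
          obtain ⟨S, hS⟩ := h'
          exact ⟨S, Or.inr hS⟩
        · simp only [SimpleGraph.CliqueFree, not_forall, not_not] at hc
          obtain ⟨S, hS⟩ := hc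
          exact ⟨S, Or.inl hS⟩)
    calc 4 * nonR.card ≤ 4 * (n.choose k * (2 * 2 ^ (U.card - k.choose 2))) :=
          Nat.mul_le_mul_left 4 hc
      _ = (4 * n.choose k) * (2 * 2 ^ (U.card - k.choose 2)) := by ring
      _ < 2 ^ k.choose 2 * (2 * 2 ^ (U.card - k.choose 2)) :=
          Nat.mul_lt_mul_of_pos_right hnum (by positivity)
      _ = 2 * 2 ^ U.card := by
          rw [show 2 ^ U.card = 2 ^ k.choose 2 * 2 ^ (U.card - k.choose 2) by
            rw [← pow_add, Nat.add_sub_cancel' hkN]]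
          ring
  have h2 : ∀ b, ∀ t ∈ range (k + 1), 4 * (k + 1) * (bad b t).card ≤ 2 ^ U.card := by
    intro b t ht
    have htk : t ≤ k := Nat.lt_succ_iff.1 (mem_range.1 ht)
    exact card_bad_le b k t ((Nat.choose_le_choose 2 (htk.trans hk)).trans (hUcard ▸ le_rfl)) hn
  have h3 : 4 * ((range (k + 1)).biUnion fun t => bad true t ∪ bad false t).card ≤ 2 * 2 ^ U.card := by
    have hsum : (k + 1) * (4 * ((range (k + 1)).biUnion fun t => bad true t ∪ bad false t).card) ≤
        (k + 1) * (2 * 2 ^ U.card) := by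
      calc (k + 1) * (4 * ((range (k + 1)).biUnion fun t => bad true t ∪ bad false t).card)
          ≤ (k + 1) * (4 * ∑ t ∈ range (k + 1), ((bad true t).card + (bad false t).card)) := by
            gcongr
            exact card_biUnion_le.trans (sum_le_sum fun t _ => card_union_le _ _)
        _ = ∑ t ∈ range (k + 1), (4 * (k + 1) * (bad true t).card + 4 * (k + 1) * (bad false t).card) := by
            rw [mul_sum, mul_sum]
            refine sum_congr rfl fun t _ => by ring
        _ ≤ ∑ _t ∈ range (k + 1), (2 ^ U.card + 2 ^ U.card) :=
            sum_le_sum fun t ht => Nat.add_le_add (h2 true t ht) (h2 false t ht)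
        _ = (k + 1) * (2 * 2 ^ U.card) := by rw [sum_const, card_range, smul_eq_mul]; ring
    exact Nat.le_of_mul_le_mul_left hsum (Nat.succ_pos k)
  have hBadlt : Bad.card < U.powerset.card := by
    rw [card_powerset, hBad]
    have := card_union_le nonR ((range (k + 1)).biUnion fun t => bad true t ∪ bad false t)
    omega
  obtain ⟨E, hEU, hEBad⟩ := exists_mem_notMem_of_card_lt_card hBadlt
  rw [hBad, mem_union, not_or, mem_biUnion] at hEBad
  obtain ⟨hE1, hE2⟩ := hEBad
  refine ⟨E, ?_, ?_⟩
  · by_contra hR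
    exact hE1 (mem_filter.2 ⟨hEU, hR⟩)
  · intro b t ht
    by_contra hlt
    push Not at hlt
    refine hE2 ⟨t, mem_range.2 (Nat.lt_succ_of_le ht), ?_⟩
    rw [mem_union]
    cases b
    · exact Or.inr (mem_filter.2 ⟨hEU, hlt⟩)
    · exact Or.inl (mem_filter.2 ⟨hEU, hlt⟩)

end Counting


/-! ### Numerics for the `ε ≤ 1/2` boundary -/

theorem factorial_sq_gt16 (k : ℕ) (hk : 4 ≤ k) : 2 ^ (k + 4) < k.factorial ^ 2 := by
  induction k with
  | zero => omega
  | succ k ih =>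
    rcases Nat.lt_or_ge k 4 with h | h
    · obtain rfl : k = 3 := by omega
      decide
    · have ih' := ih h
      have h4 : 2 ≤ (k + 1) ^ 2 := by nlinarith
      calc 2 ^ (k + 1 + 4) = 2 * 2 ^ (k + 4) := by ring
        _ < 2 * k.factorial ^ 2 := by omega
        _ ≤ (k + 1) ^ 2 * k.factorial ^ 2 := Nat.mul_le_mul_right _ h4
        _ = (k + 1).factorial ^ 2 := by rw [Nat.factorial_succ]; ring

/-- `4 C(n,k) < 2^{C(k,2)}` as soon as `n² ≤ 2^k`, `k ≥ 4`. -/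
theorem four_mul_choose_lt (n k : ℕ) (hk : 4 ≤ k) (hn : n ^ 2 ≤ 2 ^ k) :
    4 * n.choose k < 2 ^ k.choose 2 := by
  have hc : 2 * k.choose 2 = k * (k - 1) := by
    rw [Nat.choose_two_right]
    exact Nat.mul_div_cancel' (Nat.even_mul_pred_self k).two_dvd
  have hkk : k * (k - 1) + k = k * k := by
    have : k - 1 + 1 = k := by omega
    calc k * (k - 1) + k = k * (k - 1 + 1) := by ring
      _ = k * k := by rw [this]
  have h1 : k.factorial * n.choose k ≤ n ^ k := by
    rw [← Nat.descFactorial_eq_factorial_mul_choose]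
    exact Nat.descFactorial_le_pow n k
  have h2 : (n ^ k) ^ 2 ≤ 2 ^ (k * k) := by
    rw [← pow_mul, mul_comm, pow_mul, pow_mul]
    exact Nat.pow_le_pow_left hn k
  have key : k.factorial ^ 2 * (4 * n.choose k) ^ 2 < k.factorial ^ 2 * (2 ^ k.choose 2) ^ 2 := by
    calc k.factorial ^ 2 * (4 * n.choose k) ^ 2 = 16 * (k.factorial * n.choose k) ^ 2 := by ring
      _ ≤ 16 * (n ^ k) ^ 2 := by gcongr
      _ ≤ 16 * 2 ^ (k * k) := by gcongr
      _ = 2 ^ (k + 4) * 2 ^ (k * (k - 1)) := by rw [← hkk]; ring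
      _ < k.factorial ^ 2 * 2 ^ (k * (k - 1)) :=
          Nat.mul_lt_mul_of_pos_right (factorial_sq_gt16 k hk) (by positivity)
      _ = k.factorial ^ 2 * (2 ^ k.choose 2) ^ 2 := by rw [← pow_mul, ← hc]; ring
  have key' : (4 * n.choose k) ^ 2 < (2 ^ k.choose 2) ^ 2 := Nat.lt_of_mul_lt_mul_left key
  exact lt_of_pow_lt_pow_left₀ 2 (Nat.zero_le _) key'

/-- `2 m t ≤ m(m+1) + t(t-1)` (i.e. `(m-t)(m-t+1) ≥ 0`). -/
theorem two_mul_mul_le (m t : ℕ) : 2 * m * t ≤ m * (m + 1) + t * (t - 1) := by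
  rcases t with _ | t
  · simp
  rw [Nat.add_sub_cancel]
  rcases Nat.lt_or_ge m (t + 1) with h | h
  · obtain ⟨d, rfl⟩ := Nat.exists_eq_add_of_le (Nat.lt_succ_iff.1 h)
    have : 2 * m * (m + d + 1) + (d * d + d) = m * (m + 1) + (m + d + 1) * (m + d) := by ring
    exact le_iff_exists_add.2 ⟨_, this.symm⟩
  · obtain ⟨d, rfl⟩ := Nat.exists_eq_add_of_le h
    have : 2 * (t + 1 + d) * (t + 1) + (d * d + d) = (t + 1 + d) * (t + 1 + d + 1) + (t + 1) * t := by
      ring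
    exact le_iff_exists_add.2 ⟨_, this.symm⟩

/-- The per-level maximum: `(2^m)^t ≤ 2^{(m²+m)/2} · 2^{C(t,2)}` for every `t`. -/
theorem pow_pow_le (m t : ℕ) : (2 ^ m) ^ t ≤ 2 ^ ((m * m + m) / 2) * 2 ^ t.choose 2 := by
  rw [← pow_mul, ← pow_add]
  refine Nat.pow_le_pow_right two_pos ?_
  have h2 : (m * m + m) / 2 + t.choose 2 = (m * (m + 1) + t * (t - 1)) / 2 := by
    rw [Nat.choose_two_right, show m * m + m = m * (m + 1) by ring,
      ← Nat.add_div_of_dvd_right (Nat.even_mul_succ_self m).two_dvd]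
  rw [h2, Nat.le_div_iff_mul_le two_pos]
  calc m * t * 2 = 2 * m * t := by ring
    _ ≤ _ := two_mul_mul_le m t

theorem two_mul_le_two_pow (m : ℕ) (hm : 1 ≤ m) : 2 * m ≤ 2 ^ m := by
  induction m with
  | zero => omega
  | succ m ih =>
    rcases Nat.lt_or_ge m 1 with h | h
    · obtain rfl : m = 0 := by omega
      decide
    · have := ih h
      have h2 : 2 ≤ 2 ^ m := by
        calc 2 = 2 ^ 1 := by norm_num
          _ ≤ 2 ^ m := Nat.pow_le_pow_right two_pos h
      rw [pow_succ]
      omega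

/-- The brute-force budget at `n = 2^m` for the few-cliques Ramsey graphs. -/
def budget (m : ℕ) : ℕ :=
  4 * ((2 ^ m + 1) * ((2 * m + 1) * (8 * (2 * m + 1) * 2 ^ ((m * m + m) / 2))))

theorem budget_le (m : ℕ) (hm : 1 ≤ m) : budget m ≤ 2 ^ ((m * m + m) / 2 + 3 * m + 8) := by
  have h1 : 2 ^ m + 1 ≤ 2 ^ (m + 1) := by
    have := Nat.one_le_two_pow (n := m); rw [pow_succ]; omega
  have h2 : 2 * m + 1 ≤ 2 ^ (m + 1) := by
    have := two_mul_le_two_pow m hm; have := Nat.one_le_two_pow (n := m); rw [pow_succ]; omega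
  calc budget m ≤ 4 * (2 ^ (m + 1) * (2 ^ (m + 1) * (8 * 2 ^ (m + 1) * 2 ^ ((m * m + m) / 2)))) := by
        unfold budget; gcongr
    _ = 2 ^ ((m * m + m) / 2 + 3 * m + 8) := by
        rw [show (4 : ℕ) = 2 ^ 2 by norm_num, show (8 : ℕ) = 2 ^ 3 by norm_num]
        simp only [← pow_add]
        congr 1; ring

/-- **Ramsey graphs whose Ramsey-ness has cheap resolution proofs on BOTH sides.** For `m ≥ 2`
some graph on `2^m` vertices is Ramsey at `k = 2m = k(2^m)` and both its clique formulas have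
refutations with at most `budget m = 2^{m²/2 + O(m)}` lines. -/
theorem exists_ramsey_cheap (m : ℕ) (hm : 2 ≤ m) :
    ∃ E : Finset (Sym2 (Fin (2 ^ m))),
      ((gr E).CliqueFree (2 * m) ∧ (gr E)ᶜ.CliqueFree (2 * m)) ∧
      ∀ b : Bool, ∃ π : List (ResLine ℕ),
        IsResRefutation (cliqueCNF (2 ^ m) (2 * m) (adjP b E)) π ∧ π.length ≤ budget m := by
  have hn : 0 < 2 ^ m := by positivity
  have hk : 2 * m ≤ 2 ^ m + 1 := (two_mul_le_two_pow m (by omega)).trans (Nat.le_succ _)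
  have hnum : 4 * (2 ^ m).choose (2 * m) < 2 ^ (2 * m).choose 2 :=
    four_mul_choose_lt _ _ (by omega) (by rw [← pow_mul, mul_comm])
  obtain ⟨E, hR, hcount⟩ := exists_ramsey_few_cliques (2 * m) hn hk hnum
  refine ⟨E, hR, fun b => ?_⟩
  -- unsatisfiability of the formula on side `b`
  have hfree : ∀ s : Fin (2 * m) → Fin (2 ^ m), ¬ Consistent (adjP b E) s := by
    cases b
    · have h := (cliqueFree_iff_forall_not_consistent (gr E)ᶜ).1 hR.2
      rwa [decide_gr_compl_adj] at h
    · have h := (cliqueFree_iff_forall_not_consistent (gr E)).1 hR.1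
      rwa [decide_gr_adj] at h
  obtain ⟨π, hπ, hlen⟩ := exists_refutation_le_count (adjP b E) hfree
  refine ⟨π, hπ, hlen.trans ?_⟩
  unfold budget
  gcongr 4 * ((2 ^ m + 1) * ?_)
  -- `Σ_{t ≤ k} C_t ≤ (k+1) · 8(k+1) 2^{(m²+m)/2}`
  have hterm : ∀ t ∈ Finset.range (2 * m + 1),
      (cons (adjP b E) t).card ≤ 8 * (2 * m + 1) * 2 ^ ((m * m + m) / 2) := by
    intro t ht
    have htk : t ≤ 2 * m := Nat.lt_succ_iff.1 (Finset.mem_range.1 ht)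
    have h1 := hcount b t htk
    have h2 : 8 * (2 * m + 1) * (2 ^ m) ^ t ≤
        2 ^ t.choose 2 * (8 * (2 * m + 1) * 2 ^ ((m * m + m) / 2)) := by
      calc 8 * (2 * m + 1) * (2 ^ m) ^ t ≤ 8 * (2 * m + 1) * (2 ^ ((m * m + m) / 2) * 2 ^ t.choose 2) :=
            Nat.mul_le_mul_left _ (pow_pow_le m t)
        _ = 2 ^ t.choose 2 * (8 * (2 * m + 1) * 2 ^ ((m * m + m) / 2)) := by ring
    exact Nat.le_of_mul_le_mul_left (h1.trans h2) (by positivity)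
  calc ∑ t ∈ Finset.range (2 * m + 1), (cons (adjP b E) t).card
      ≤ ∑ _t ∈ Finset.range (2 * m + 1), 8 * (2 * m + 1) * 2 ^ ((m * m + m) / 2) :=
        Finset.sum_le_sum hterm
    _ = (2 * m + 1) * (8 * (2 * m + 1) * 2 ^ ((m * m + m) / 2)) := by
        rw [Finset.sum_const, Finset.card_range, smul_eq_mul]

/-- **Boundary lemma: the crux forces `ε ≤ 1/2`.** Random-like Ramsey graphs at `n = 2^m` have
both clique formulas refuted in `2^{m²/2 + O(m)} = n^{(1/2 + o(1)) log₂ n}` lines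
(`exists_ramsey_cheap`), so `ResolutionUncertaintyWith ε → ε ≤ 1/2`: any proof of the crux must
produce an exponent at most `1/2`, and the conjectured truth (`Θ(log n)` exponent with a small
constant, LPRT for the binary encoding) sits below this line. -/
theorem eps_le_half_of_with {ε : ℝ} (h : ResolutionUncertaintyWith ε) : ε ≤ 1 / 2 := by
  refine le_of_not_gt fun hε => ?_
  obtain ⟨n₀, hn⟩ := h
  set m : ℕ := max (max n₀ 2) ⌈20 / (ε - 1 / 2)⌉₊ with hm
  have hm2 : 2 ≤ m := (le_max_right _ _).trans (le_max_left _ _)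
  have hn₀ : n₀ ≤ 2 ^ m := ((le_max_left _ _).trans (le_max_left _ _)).trans (le_two_pow m)
  have hmε : 20 ≤ (ε - 1 / 2) * m := by
    have hpos : 0 < ε - 1 / 2 := by linarith
    have h1 : (20 / (ε - 1 / 2) : ℝ) ≤ m := (Nat.le_ceil _).trans (by exact_mod_cast le_max_right _ _)
    rw [div_le_iff₀ hpos] at h1
    linarith
  obtain ⟨E, -, hcheap⟩ := exists_ramsey_cheap m hm2
  obtain ⟨π₁, hπ₁, hl₁⟩ := hcheap true
  obtain ⟨π₂, hπ₂, hl₂⟩ := hcheap false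
  have hk : kR (2 ^ m) = 2 * m := kR_two_pow m
  have hπ₁' : IsResRefutation (cliqueCNF (2 ^ m) (kR (2 ^ m)) fun u v => decide ((gr E).Adj u v)) π₁ := by
    rw [decide_gr_adj, hk]; exact hπ₁
  have hπ₂' : IsResRefutation (cliqueCNF (2 ^ m) (kR (2 ^ m)) fun u v => decide ((gr E)ᶜ.Adj u v)) π₂ := by
    rw [decide_gr_compl_adj, hk]; exact hπ₂
  have hle := hn (2 ^ m) hn₀ (gr E) π₁ π₂ hπ₁' hπ₂'
  rw [rpow_logb_two_pow] at hle
  have hB := budget_le m (by omega)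
  have hBR : (budget m : ℝ) ≤ (2 : ℝ) ^ (((m * m + m) / 2 + 3 * m + 8 : ℕ) : ℝ) := by
    rw [Real.rpow_natCast]; exact_mod_cast hB
  have hmax : max (π₁.length : ℝ) (π₂.length : ℝ) ≤ (2 : ℝ) ^ (((m * m + m) / 2 + 3 * m + 8 : ℕ) : ℝ) :=
    max_le (le_trans (by exact_mod_cast hl₁) hBR) (le_trans (by exact_mod_cast hl₂) hBR)
  have hexp : ε * m * m ≤ (((m * m + m) / 2 + 3 * m + 8 : ℕ) : ℝ) :=
    (Real.rpow_le_rpow_left_iff (by norm_num : (1 : ℝ) < 2)).1 (hle.trans hmax)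
  have hdiv : (((m * m + m) / 2 : ℕ) : ℝ) ≤ ((m * m + m : ℕ) : ℝ) / 2 := Nat.cast_div_le
  have hm1 : (2 : ℝ) ≤ m := by exact_mod_cast hm2
  push_cast at hexp hdiv
  nlinarith

/-- In particular no exponent `ε > 1/2` works in the crux. -/
theorem not_resolutionUncertaintyWith_of_half_lt {ε : ℝ} (hε : 1 / 2 < ε) :
    ¬ ResolutionUncertaintyWith ε := fun h => (not_le.2 hε) (eps_le_half_of_with h)

end Summit.PneNP.PneNP.Cruxes.ResolutionUncertainty.Disproof
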